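import Mathlib.LinearAlgebra.Basis.VectorSpace
import Mathlib.LinearAlgebra.FiniteDimensional.Lemmas
import Mathlib.LinearAlgebra.Dimension.Constructions
import Mathlib.FieldTheory.Finiteness
import Mathlib.Analysis.SpecificLimits.Normed
import Mathlib.Data.Nat.Log
import Literature.Combinatorics.Additive.TightTriangleRemoval
import HarnessLib

/-!
# Proof of Fox–Lovász 2017, Theorem 1 (tight arithmetic triangle removal in `𝔽_pⁿ`)

This file discharges the named fact `Literature.Combinatorics.Additive.FoxLovasz2017_thm1`
(`TightTriangleRemoval.lean`) by formalising the printed proof of J. Fox, L. M. Lovász, *A tight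
bound for Green's arithmetic triangle removal lemma in vector spaces*, Adv. Math. 321 (2017) /
SODA 2017, §2 (pp. 5–7 of arXiv:1606.01230v3), on top of the tree's PROVED tricolored sum-free
bound `Literature.Barriers.MatrixMultiplication.BCCGNSU2017_thm414_holds` (BCCGNSU 2017, Thm. 4.14:
a tricolored sum-free set in `H ≅ 𝔽_p^d × G` has size `≤ 3 |H| J(p)^d = 3 p^{(1−c_p)d}|G|`, i.e.
Fox–Lovász's Thm. 2 up to the factor `3`).

## Structure (mirrors §2 of the paper; all in `namespace FoxLovasz2017`, one `section Main`)

Throughout `V` is a finite `𝔽_p`-vector space (`p` prime, `[Fact p.Prime]`), `N = |V|`, and the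
triangles of `X × Y × Z` are counted as pairs `(x, y) ∈ X × Y` with `−(x + y) ∈ Z` (local notation
`Tri[X, Y, Z]`; `card_filter_triple_eq_card_tri` identifies this with the ordered-triple count of
the vendored statement).

* *Counting linear maps* — `card_filter_linearMap_apply_eq`: linear maps `V → W` with prescribed
  values on a linearly independent family form a fraction `|W|^{−k}` (the probabilities of the
  random-subspace argument).
* *Lemma 5* (`lemma5`) — few triangles when all degrees are `≤ ρN` in a *generic* configuration
  ((G1) the two free vertices of a triangle are linearly independent, (G2') a triangle is pinned
  down by the span of another). DEVIATION: the paper's uniformly random `d`-dimensional subspace is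
  replaced by the kernel of a uniformly random linear map `f : V → 𝔽_p^{n−d}` (exact conditional
  probabilities; the excess dimension of `ker f` is paid for by `E|ker f| ≤ 1 + p^d`,
  `sum_card_ker_mul_le`). Good triangles in `ker f` are tricolored sum-free
  (`isTricoloredSumFree_good`) and are bounded by BCCGNSU Thm. 4.14 in `ker f ≅ 𝔽_p^{dim}`
  (`card_good_le`); Claim 1 is the union bound `card_mul_le_card_good`.
  Result: `T ≤ 211 p² ρ^{1+c_p} N²` (paper: `125 p² ρ^{1+c_p}` with the sharp Thm. 2).
* *Lemma 6* (`lemma6`) — iterated removal of high-degree vertices (`removal_process`).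
  DEVIATION: the paper's dyadic count of removed points (with `g = log²`) is replaced by the
  potential `m / log(N²/T)`, which drops by `≥ 1` at each removal of a vertex of degree
  `≥ 2 log²(N²/T) T/m` (`potential_step`, using only `1 − 1/x ≤ log x`); the monotonicity of
  `δ^c log(1/δ)^{2(1+c)}` is `rpow_mul_log_rpow_le` (from `1 + x ≤ eˣ`). Result, for `m ≥ 1`
  disjoint generic triangles with `δ₀ = T/N² ≤ e^{−2(1+c_p)/c_p}`:
  `(m/N)^{1+c_p} ≤ 100 p⁶ δ₀^{c_p} log(1/δ₀)^{2(1+c_p)}`.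
* *Theorem 4* (`theorem4`) — the `𝔽_p^{n+2}` embedding `xᵢ ↦ (xᵢ,1,0)`, `yᵢ ↦ (yᵢ,−1,1)`,
  `zᵢ ↦ (zᵢ,0,−1)` makes any family of disjoint triangles generic (`card_tri_embed`, `embed_G1`,
  `embed_G2`), whence, with `N' = p²N`:
  `T > e^{−2(1+c_p)/c_p} N'²  ∨  (m/N')^{1+c_p} ≤ 100 p⁶ (T/N'²)^{c_p} log(N'²/T)^{2(1+c_p)}`.
* *Theorem 3* (`theorem3`) — `m = εN` disjoint triangles span `≥ ε^{C_p} N²` triangles: Theorem 4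
  for the `k`-th powers `X^k ⊆ V^k` (`card_tri_pow`) and `k → ∞` (`exists_pow_mul_rpow_lt`).
* *Theorem 1* (`theorem1`) from Theorem 3 by a maximum family of disjoint triangles, and the
  discharge `FoxLovasz2017_thm1_holds`.

Constants: `c_p = foxLovaszExponent p` with `p^{−c_p} = J(p)` (`rpow_neg_foxLovaszExponent`),
`0 < c_p ≤ 1` (`foxLovaszExponent_le_one`), `C_p = 1 + 1/c_p = foxLovaszRemovalExponent p`.

## References

* [FoxLovasz2017] J. Fox, L. M. Lovász, *A tight bound for Green's arithmetic triangle removal lemma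
  in vector spaces*, Adv. Math. 321 (2017) 287–297; arXiv:1606.01230 — §2: Thm. 3, Thm. 4,
  Lemma 5 (Claims 1–2), Lemma 6, proofs of Thm. 4 and Thm. 3 (pp. 5–7).
* [BlasiakChurchCohnGrochowNaslundSawinUmans2017] J. Blasiak et al., *On cap sets and the
  group-theoretic approach to matrix multiplication*, Discrete Analysis 2017:3 — Thm. 4.14.
-/

noncomputable section

open Finset
open scoped BigOperators

namespace Literature.Combinatorics.Additive

namespace FoxLovasz2017

open Literature.Barriers.MatrixMultiplication (bccgnsuJ BCCGNSU2017_thm414_holds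
  bccgnsuJ_le_exp_neg_delta bccgnsuDelta_pos)

/-! ### Counting linear maps with prescribed values -/

section Counting

/-- All fibres of a surjective homomorphism `φ : A → B` of finite additive groups have cardinality
`|A| / |B|`. [folklore] -/
theorem card_filter_apply_eq_mul_card {A B : Type*} [AddGroup A] [AddGroup B] [Fintype A]
    [Fintype B] [DecidableEq B] (φ : A →+ B) (hφ : Function.Surjective φ) (b : B) :
    (univ.filter fun a => φ a = b).card * Fintype.card B = Fintype.card A := by
  have hfib : ∀ b' : B, (univ.filter fun a => φ a = b').card =
      (univ.filter fun a => φ a = 0).card := by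
    intro b'
    obtain ⟨a₀, ha₀⟩ := hφ b'
    refine card_bij (fun a _ => a - a₀) (fun a ha => ?_) (fun a₁ _ a₂ _ h => sub_left_injective h)
      (fun c hc => ⟨c + a₀, ?_, add_sub_cancel_right c a₀⟩)
    · simp only [mem_filter, mem_univ, true_and] at ha ⊢
      rw [map_sub, ha, ha₀, sub_self]
    · simp only [mem_filter, mem_univ, true_and] at hc ⊢
      rw [map_add, hc, ha₀, zero_add]
  rw [← card_univ (α := A), card_eq_sum_card_fiberwise (f := φ) (s := univ) (t := univ)
    (fun a _ => mem_coe.2 (mem_univ (φ a))), Finset.sum_congr rfl fun b' _ => hfib b', sum_const,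
    card_univ, smul_eq_mul, hfib b, mul_comm]

variable {K : Type*} [DivisionRing K] {V W : Type*} [AddCommGroup V] [Module K V] [AddCommGroup W]
  [Module K W]

/-- A linear map may be prescribed arbitrarily on a linearly independent family (over a division
ring). [folklore] -/
theorem exists_linearMap_apply_eq {k : ℕ} {v : Fin k → V} (hv : LinearIndependent K v)
    (c : Fin k → W) : ∃ f : V →ₗ[K] W, ∀ i, f (v i) = c i := by
  classical
  have hinj : Function.Injective (Fintype.linearCombination K v) :=
    linearIndependent_iff_injective_fintypeLinearCombination.1 hv
  obtain ⟨g, hg⟩ := (Fintype.linearCombination K v).exists_leftInverse_of_injective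
    (LinearMap.ker_eq_bot.2 hinj)
  refine ⟨(Fintype.linearCombination K c).comp g, fun i => ?_⟩
  have h1 : g (v i) = Pi.single i 1 := by
    have h := LinearMap.congr_fun hg (Pi.single i 1)
    rw [LinearMap.comp_apply, Fintype.linearCombination_apply_single, one_smul,
      LinearMap.id_apply] at h
    exact h
  rw [LinearMap.comp_apply, h1, Fintype.linearCombination_apply_single, one_smul]

/-- **Counting lemma**: among the linear maps `V → W` (`W` finite), those taking prescribed values
`c i` on a linearly independent family `v : Fin k → V` form a fraction exactly `|W|^{−k}`.
(The "probability that `k` independent vectors lie in a random subspace" of Fox–Lovász, proof of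
Lemma 5, in the random-kernel model.) [folklore] -/
theorem card_filter_linearMap_apply_eq [Fintype W] [DecidableEq W] [Fintype (V →ₗ[K] W)] {k : ℕ}
    {v : Fin k → V} (hv : LinearIndependent K v) (c : Fin k → W) :
    (univ.filter fun f : V →ₗ[K] W => ∀ i, f (v i) = c i).card * Fintype.card W ^ k =
      Fintype.card (V →ₗ[K] W) := by
  classical
  let φ : (V →ₗ[K] W) →+ (Fin k → W) :=
    { toFun := fun f i => f (v i)
      map_zero' := rfl
      map_add' := fun _ _ => rfl }
  have hφ : Function.Surjective φ := fun c' => by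
    obtain ⟨f, hf⟩ := exists_linearMap_apply_eq hv c'
    exact ⟨f, funext hf⟩
  have h := card_filter_apply_eq_mul_card φ hφ c
  rw [Fintype.card_fun, Fintype.card_fin] at h
  rw [← h]
  congr 2
  ext f
  simp only [mem_filter, mem_univ, true_and, funext_iff]
  exact Iff.rfl

end Counting

/-! ### Lemma 5: the random-kernel argument -/

section Main

variable {p : ℕ} [hp : Fact p.Prime]
variable {V : Type} [AddCommGroup V] [Module (ZMod p) V] [Fintype V] [DecidableEq V]

/-- The triangles of `X × Y × Z`, as pairs `(x, y) ∈ X × Y` with `−(x + y) ∈ Z`. -/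
local notation3 (prettyPrint := false) "Tri[" X ", " Y ", " Z "]" =>
  (X ×ˢ Y).filter (fun t => -(t.1 + t.2) ∈ Z)

/-- The triangles of `X × Y × Z` inside the kernel of `f`. -/
local notation3 (prettyPrint := false) "TriK[" f ", " X ", " Y ", " Z "]" =>
  Finset.filter (fun t : V × V => f t.1 = 0 ∧ f t.2 = 0) (Tri[X, Y, Z])

/-- The *good* triangles for `f` (proof of Lemma 5): triangles in `ker f` sharing no vertex with
another triangle in `ker f`. -/
local notation3 (prettyPrint := false) "Good[" f ", " X ", " Y ", " Z "]" =>
  Finset.filter (fun t : V × V => ∀ t' ∈ TriK[f, X, Y, Z], t' ≠ t →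
    (t'.1 ≠ t.1 ∧ t'.2 ≠ t.2 ∧ t'.1 + t'.2 ≠ t.1 + t.2)) (TriK[f, X, Y, Z])

omit [Module (ZMod p) V] [Fintype V] in
/-- Membership in the triangle finset. [cite: FoxLovasz2017, §1] -/
theorem mem_tri {X Y Z : Finset V} {t : V × V} :
    t ∈ Tri[X, Y, Z] ↔ t.1 ∈ X ∧ t.2 ∈ Y ∧ -(t.1 + t.2) ∈ Z := by
  simp only [mem_filter, mem_product, and_assoc]

/-- **Good triangles are tricolored sum-free** (proof of Lemma 5: "the set of good triangles
satisfies the hypothesis of Theorem 2"). [cite: FoxLovasz2017, Lemma 5 (proof)] -/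
theorem isTricoloredSumFree_good {r : ℕ} (f : V →ₗ[ZMod p] (Fin r → ZMod p)) (X Y Z : Finset V) :
    IsTricoloredSumFree (fun i : Good[f, X, Y, Z] => i.1.1) (fun i => i.1.2)
      (fun i => -(i.1.1 + i.1.2)) := by
  intro i j k
  constructor
  · intro h
    obtain ⟨hi1, hi2⟩ := mem_filter.1 i.2
    obtain ⟨hj1, -⟩ := mem_filter.1 j.2
    obtain ⟨hk1, -⟩ := mem_filter.1 k.2
    obtain ⟨hi11, hi12⟩ := mem_filter.1 hi1
    obtain ⟨hj11, hj12⟩ := mem_filter.1 hj1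
    obtain ⟨hk11, -⟩ := mem_filter.1 hk1
    -- the triangle `(xᵢ, yⱼ, z_k)` lies in `ker f`
    have hsum : i.1.1 + j.1.2 = k.1.1 + k.1.2 := by
      have h' : i.1.1 + j.1.2 - (k.1.1 + k.1.2) = 0 := by rw [sub_eq_add_neg]; exact h
      exact sub_eq_zero.1 h'
    have ht' : ((i.1.1, j.1.2) : V × V) ∈ TriK[f, X, Y, Z] := by
      refine mem_filter.2 ⟨mem_tri.2 ⟨(mem_tri.1 hi11).1, (mem_tri.1 hj11).2.1, ?_⟩, hi12.1, hj12.2⟩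
      rw [hsum]; exact (mem_tri.1 hk11).2.2
    -- by goodness of `i` it is the triangle `i`
    have h1 : ((i.1.1, j.1.2) : V × V) = i.1 := by
      by_contra hne
      exact (hi2 _ ht' hne).1 rfl
    have hj2 : j.1.2 = i.1.2 := by
      have := congrArg Prod.snd h1; simpa using this
    have hij : i = j := by
      by_contra hne
      have hne' : j.1 ≠ i.1 := fun e => hne (Subtype.ext e).symm
      exact (hi2 _ hj1 hne').2.1 hj2
    have hik : i = k := by
      by_contra hne
      have hne' : k.1 ≠ i.1 := fun e => hne (Subtype.ext e).symm
      refine (hi2 _ hk1 hne').2.2 ?_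
      rw [← hsum, hj2]
    exact ⟨hij, hij.symm.trans hik⟩
  · rintro ⟨rfl, rfl⟩
    simp only
    rw [add_neg_cancel]

/-- **Upper bound on the number of good triangles** (proof of Lemma 5: "`T` is always at most
`p^{(1−c_p)d}`", here via BCCGNSU Thm. 4.14 inside `ker f ≅ 𝔽_p^{dim ker f}`):
`#good ≤ 3 · |ker f| · J(p)^{dim ker f}`. [cite: FoxLovasz2017, Lemma 5 (proof)]
[cite: BlasiakChurchCohnGrochowNaslundSawinUmans2017, Thm. 4.14] -/
theorem card_good_le {r : ℕ} (f : V →ₗ[ZMod p] (Fin r → ZMod p)) (X Y Z : Finset V) :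
    ((Good[f, X, Y, Z]).card : ℝ) ≤
      3 * (univ.filter fun v : V => f v = 0).card *
        bccgnsuJ p ^ Module.finrank (ZMod p) (LinearMap.ker f) := by
  classical
  set H := LinearMap.ker f with hH
  haveI : Module.Finite (ZMod p) H := Module.Finite.of_finite
  let b := Module.finBasis (ZMod p) H
  let e : H ≃+ ((Fin (Module.finrank (ZMod p) H) → ZMod p) × PUnit) :=
    b.equivFun.toAddEquiv.trans (AddEquiv.prodUnique).symm
  -- the good triangles, as families valued in `H = ker f`
  have hmem1 : ∀ i : Good[f, X, Y, Z], (i.1.1 : V) ∈ H := fun i =>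
    (LinearMap.mem_ker).2 (mem_filter.1 (mem_filter.1 i.2).1).2.1
  have hmem2 : ∀ i : Good[f, X, Y, Z], (i.1.2 : V) ∈ H := fun i =>
    (LinearMap.mem_ker).2 (mem_filter.1 (mem_filter.1 i.2).1).2.2
  have hmem3 : ∀ i : Good[f, X, Y, Z], (-(i.1.1 + i.1.2) : V) ∈ H := fun i =>
    H.neg_mem (H.add_mem (hmem1 i) (hmem2 i))
  let s : Good[f, X, Y, Z] → H := fun i => ⟨i.1.1, hmem1 i⟩
  let t : Good[f, X, Y, Z] → H := fun i => ⟨i.1.2, hmem2 i⟩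
  let u : Good[f, X, Y, Z] → H := fun i => ⟨-(i.1.1 + i.1.2), hmem3 i⟩
  have hstu : IsTricoloredSumFree s t u := by
    intro i j k
    rw [← isTricoloredSumFree_good f X Y Z i j k]
    simp only [s, t, u]
    rw [← Subtype.coe_inj]
    simp only [Submodule.coe_add, Submodule.coe_zero]
  have hmain := BCCGNSU2017_thm414_holds p (Module.finrank (ZMod p) H) hp.out.isPrimePow PUnit H
    ⟨e⟩ _ s t u hstu
  have hcardι : Fintype.card (Good[f, X, Y, Z]) = (Good[f, X, Y, Z]).card := Fintype.card_coe _
  have hcardH : Fintype.card H = (univ.filter fun v : V => f v = 0).card := by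
    rw [hH, Fintype.card_subtype]
    congr 1
    ext v
    simp only [mem_filter, mem_univ, true_and, LinearMap.mem_ker]
  rw [hcardι, hcardH] at hmain
  exact hmain

/-- The triangles of `X × Y × Z` sharing a vertex with `t` (other than `t`). -/
local notation3 (prettyPrint := false) "Conf[" t ", " X ", " Y ", " Z "]" =>
  Finset.filter (fun t' : V × V => t' ≠ t ∧ (t'.1 = t.1 ∨ t'.2 = t.2 ∨ t'.1 + t'.2 = t.1 + t.2))
    (Tri[X, Y, Z])

omit [Module (ZMod p) V] [Fintype V] in
/-- At most `3D` triangles share a vertex with a given triangle when every vertex lies in at most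
`D` triangles (proof of Lemma 5, Claim 1: the union bound runs over these).
[cite: FoxLovasz2017, Lemma 5 (Claim 1)] -/
theorem card_conf_le {X Y Z : Finset V} {D : ℕ} (t : V × V)
    (hD1 : ((Tri[X, Y, Z]).filter fun t' : V × V => t'.1 = t.1).card ≤ D)
    (hD2 : ((Tri[X, Y, Z]).filter fun t' : V × V => t'.2 = t.2).card ≤ D)
    (hD3 : ((Tri[X, Y, Z]).filter fun t' : V × V => t'.1 + t'.2 = t.1 + t.2).card ≤ D) :
    (Conf[t, X, Y, Z]).card ≤ 3 * D := by
  calc (Conf[t, X, Y, Z]).card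
      ≤ (((Tri[X, Y, Z]).filter fun t' : V × V => t'.1 = t.1) ∪
          ((Tri[X, Y, Z]).filter fun t' : V × V => t'.2 = t.2) ∪
          ((Tri[X, Y, Z]).filter fun t' : V × V => t'.1 + t'.2 = t.1 + t.2)).card := by
        refine card_le_card fun t' ht' => ?_
        obtain ⟨h1, -, h2 | h2 | h2⟩ := mem_filter.1 ht'
        · exact mem_union_left _ (mem_union_left _ (mem_filter.2 ⟨h1, h2⟩))
        · exact mem_union_left _ (mem_union_right _ (mem_filter.2 ⟨h1, h2⟩))
        · exact mem_union_right _ (mem_filter.2 ⟨h1, h2⟩)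
    _ ≤ D + D + D := by
        refine (card_union_le _ _).trans (Nat.add_le_add ((card_union_le _ _).trans
          (Nat.add_le_add hD1 hD2)) hD3)
    _ = 3 * D := by ring

omit [AddCommGroup V] [Module (ZMod p) V] [Fintype V] [DecidableEq V] in
/-- `Set.range ![x, y] = {x, y}`. [folklore] -/
theorem range_vec2 (x y : V) : Set.range ![x, y] = {x, y} := by
  simp only [Matrix.range_cons, Matrix.range_empty, Set.union_empty, Set.singleton_union]

/-- **Claim 1 of Lemma 5, counted over all linear maps**: for a triangle `t` of a generic
configuration with all degrees `≤ D`,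
`|Hom(V,W)| · |W| ≤ #{f : t good for f} · |W|³ + 3D · |Hom(V,W)|`, i.e.
`P(t good) ≥ P(t ⊆ ker f) − Σ_{t' conflicting} P(t ∪ t' ⊆ ker f) = |W|^{−2} − 3D|W|^{−3}`.
[cite: FoxLovasz2017, Lemma 5 (Claim 1)] -/
theorem card_mul_le_card_good {X Y Z : Finset V} {r : ℕ}
    [Fintype (V →ₗ[ZMod p] (Fin r → ZMod p))]
    (hG1 : ∀ t ∈ Tri[X, Y, Z], LinearIndependent (ZMod p) ![t.1, t.2])
    (hG2 : ∀ t ∈ Tri[X, Y, Z], ∀ t' ∈ Tri[X, Y, Z], t'.1 ∈ Submodule.span (ZMod p) {t.1, t.2} →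
      t'.2 ∈ Submodule.span (ZMod p) {t.1, t.2} → t' = t)
    {D : ℕ} (hdeg : ∀ t ∈ Tri[X, Y, Z],
      ((Tri[X, Y, Z]).filter fun t' : V × V => t'.1 = t.1).card ≤ D ∧
      ((Tri[X, Y, Z]).filter fun t' : V × V => t'.2 = t.2).card ≤ D ∧
      ((Tri[X, Y, Z]).filter fun t' : V × V => t'.1 + t'.2 = t.1 + t.2).card ≤ D)
    {t : V × V} (ht : t ∈ Tri[X, Y, Z]) :
    Fintype.card (V →ₗ[ZMod p] (Fin r → ZMod p)) * Fintype.card (Fin r → ZMod p) ≤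
      (univ.filter fun f : V →ₗ[ZMod p] (Fin r → ZMod p) => t ∈ Good[f, X, Y, Z]).card *
          Fintype.card (Fin r → ZMod p) ^ 3 +
        3 * D * Fintype.card (V →ₗ[ZMod p] (Fin r → ZMod p)) := by
  classical
  -- `S₂`: maps killing `t`
  let S₂ := (univ.filter fun f : V →ₗ[ZMod p] (Fin r → ZMod p) => f t.1 = 0 ∧ f t.2 = 0)
  have hS₂card : S₂.card * (Fintype.card (Fin r → ZMod p)) ^ 2 = (Fintype.card (V →ₗ[ZMod p] (Fin r → ZMod p))) := by
    have h := card_filter_linearMap_apply_eq (W := Fin r → ZMod p) (hG1 t ht) (fun _ => 0)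
    rw [← h]
    congr 2
    ext f
    simp only [S₂, mem_filter, mem_univ, true_and, Fin.forall_fin_two, Matrix.cons_val_zero,
      Matrix.cons_val_one]
  -- `S₄ t'`: maps killing `t` and `t'`
  let S₄ : V × V → Finset (V →ₗ[ZMod p] (Fin r → ZMod p)) := fun t' =>
    univ.filter fun f => (f t.1 = 0 ∧ f t.2 = 0) ∧ (f t'.1 = 0 ∧ f t'.2 = 0)
  have hS₄card : ∀ t' ∈ Conf[t, X, Y, Z], (S₄ t').card * (Fintype.card (Fin r → ZMod p)) ^ 3 ≤ (Fintype.card (V →ₗ[ZMod p] (Fin r → ZMod p))) := by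
    intro t' ht'
    obtain ⟨ht'T, hne, -⟩ := mem_filter.1 ht'
    -- a vertex of `t'` outside `span {t.1, t.2}`
    obtain ⟨w₀, hw₀, hw₀S⟩ : ∃ w₀ : V, w₀ ∉ Submodule.span (ZMod p) {t.1, t.2} ∧
        ∀ f ∈ S₄ t', f w₀ = 0 := by
      by_cases h1 : t'.1 ∈ Submodule.span (ZMod p) {t.1, t.2}
      · refine ⟨t'.2, fun h2 => hne (hG2 t ht t' ht'T h1 h2), fun f hf => ?_⟩
        exact (mem_filter.1 hf).2.2.2
      · exact ⟨t'.1, h1, fun f hf => (mem_filter.1 hf).2.2.1⟩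
    have hli : LinearIndependent (ZMod p) ![w₀, t.1, t.2] := by
      have h := (linearIndependent_finCons (x := w₀) (v := ![t.1, t.2])).2
        ⟨hG1 t ht, by rwa [range_vec2]⟩
      exact h
    have h := card_filter_linearMap_apply_eq (W := Fin r → ZMod p) hli (fun _ => 0)
    rw [← h]
    refine Nat.mul_le_mul_right _ (card_le_card fun f hf => ?_)
    have hf' := mem_filter.1 hf
    simp only [mem_filter, mem_univ, true_and, Fin.forall_fin_succ, Matrix.cons_val_zero,
      Matrix.cons_val_succ]
    exact ⟨hw₀S f hf, hf'.2.1.1, hf'.2.1.2, fun i => i.elim0⟩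
  -- `S₂ ⊆ {t good} ∪ ⋃_{t'} S₄ t'`
  have hsub : S₂ ⊆ (univ.filter fun f : V →ₗ[ZMod p] (Fin r → ZMod p) => t ∈ Good[f, X, Y, Z]) ∪
      (Conf[t, X, Y, Z]).biUnion S₄ := by
    intro f hf
    obtain ⟨-, hf1, hf2⟩ := mem_filter.1 hf
    rw [mem_union, mem_filter, mem_biUnion]
    by_cases hgood : t ∈ Good[f, X, Y, Z]
    · exact Or.inl ⟨mem_univ _, hgood⟩
    · right
      have htK : t ∈ TriK[f, X, Y, Z] := mem_filter.2 ⟨ht, hf1, hf2⟩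
      have : ¬ ∀ t' ∈ TriK[f, X, Y, Z], t' ≠ t →
          (t'.1 ≠ t.1 ∧ t'.2 ≠ t.2 ∧ t'.1 + t'.2 ≠ t.1 + t.2) := fun h =>
        hgood (mem_filter.2 ⟨htK, h⟩)
      push Not at this
      obtain ⟨t', ht'K, hne, hshare⟩ := this
      obtain ⟨ht'T, hf'1, hf'2⟩ := mem_filter.1 ht'K
      refine ⟨t', mem_filter.2 ⟨ht'T, hne, ?_⟩, mem_filter.2 ⟨mem_univ _, ⟨hf1, hf2⟩, hf'1, hf'2⟩⟩
      by_cases h1 : t'.1 = t.1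
      · exact Or.inl h1
      by_cases h2 : t'.2 = t.2
      · exact Or.inr (Or.inl h2)
      · exact Or.inr (Or.inr (hshare h1 h2))
  have hconf : (Conf[t, X, Y, Z]).card ≤ 3 * D :=
    card_conf_le t (hdeg t ht).1 (hdeg t ht).2.1 (hdeg t ht).2.2
  calc (Fintype.card (V →ₗ[ZMod p] (Fin r → ZMod p))) * (Fintype.card (Fin r → ZMod p)) = S₂.card * (Fintype.card (Fin r → ZMod p)) ^ 3 := by rw [← hS₂card]; ring
    _ ≤ ((univ.filter fun f : V →ₗ[ZMod p] (Fin r → ZMod p) => t ∈ Good[f, X, Y, Z]).card +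
          ∑ t' ∈ Conf[t, X, Y, Z], (S₄ t').card) * (Fintype.card (Fin r → ZMod p)) ^ 3 :=
        Nat.mul_le_mul_right _ ((card_le_card hsub).trans
          ((card_union_le _ _).trans (Nat.add_le_add_left card_biUnion_le _)))
    _ = (univ.filter fun f : V →ₗ[ZMod p] (Fin r → ZMod p) => t ∈ Good[f, X, Y, Z]).card * (Fintype.card (Fin r → ZMod p)) ^ 3 +
          ∑ t' ∈ Conf[t, X, Y, Z], (S₄ t').card * (Fintype.card (Fin r → ZMod p)) ^ 3 := by
        rw [add_mul, sum_mul]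
    _ ≤ (univ.filter fun f : V →ₗ[ZMod p] (Fin r → ZMod p) => t ∈ Good[f, X, Y, Z]).card * (Fintype.card (Fin r → ZMod p)) ^ 3 +
          ∑ _t' ∈ Conf[t, X, Y, Z], (Fintype.card (V →ₗ[ZMod p] (Fin r → ZMod p))) := Nat.add_le_add_left (sum_le_sum hS₄card) _
    _ ≤ _ := by
        rw [sum_const, smul_eq_mul]
        exact Nat.add_le_add_left ((Nat.mul_le_mul_right _ hconf).trans_eq (by ring)) _

/-- **Expected size of the random kernel**: `Σ_f |ker f| · |W| ≤ |Hom(V,W)| · (|W| + |V|)`, i.e.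
`E|ker f| ≤ 1 + |V|/|W|` (each nonzero vector lies in `ker f` with probability `|W|^{−1}`).
[cite: FoxLovasz2017, Lemma 5 (proof)] -/
theorem sum_card_ker_mul_le {r : ℕ} [Fintype (V →ₗ[ZMod p] (Fin r → ZMod p))] :
    (∑ f : V →ₗ[ZMod p] (Fin r → ZMod p), (univ.filter fun v : V => f v = 0).card) *
        Fintype.card (Fin r → ZMod p) ≤
      Fintype.card (V →ₗ[ZMod p] (Fin r → ZMod p)) *
        (Fintype.card (Fin r → ZMod p) + Fintype.card V) := by
  classical
  -- double counting
  have hswap : (∑ f : V →ₗ[ZMod p] (Fin r → ZMod p), (univ.filter fun v : V => f v = 0).card) =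
      ∑ v : V, (univ.filter fun f : V →ₗ[ZMod p] (Fin r → ZMod p) => f v = 0).card := by
    simp only [card_filter]
    exact sum_comm
  -- the fibres
  have hv : ∀ v : V, v ≠ 0 →
      (univ.filter fun f : V →ₗ[ZMod p] (Fin r → ZMod p) => f v = 0).card * (Fintype.card (Fin r → ZMod p)) = (Fintype.card (V →ₗ[ZMod p] (Fin r → ZMod p))) := by
    intro v hv0
    have hli : LinearIndependent (ZMod p) ![v] := by
      refine Fintype.linearIndependent_iff.2 fun g hg i => ?_
      rw [Fin.sum_univ_one, Matrix.cons_val_fin_one] at hg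
      rw [Subsingleton.elim i 0]
      exact (smul_eq_zero.1 hg).resolve_right hv0
    have h := card_filter_linearMap_apply_eq (W := Fin r → ZMod p) hli (fun _ => 0)
    rw [pow_one] at h
    rw [← h]
    congr 2
    ext f
    simp only [mem_filter, mem_univ, true_and, Fin.forall_fin_one, Matrix.cons_val_fin_one]
  have h0 : (univ.filter fun f : V →ₗ[ZMod p] (Fin r → ZMod p) => f 0 = 0).card = (Fintype.card (V →ₗ[ZMod p] (Fin r → ZMod p))) := by
    rw [← card_univ]
    congr 1
    exact filter_true_of_mem fun f _ => map_zero f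
  rw [hswap, ← Finset.add_sum_erase _ _ (mem_univ (0 : V)), add_mul, h0, sum_mul]
  have hrest : ∑ v ∈ univ.erase (0 : V),
      (univ.filter fun f : V →ₗ[ZMod p] (Fin r → ZMod p) => f v = 0).card * (Fintype.card (Fin r → ZMod p)) =
        ∑ _v ∈ univ.erase (0 : V), (Fintype.card (V →ₗ[ZMod p] (Fin r → ZMod p))) :=
    sum_congr rfl fun v hv' => hv v (ne_of_mem_erase hv')
  rw [hrest, sum_const, smul_eq_mul, card_erase_of_mem (mem_univ _), card_univ, mul_add, mul_comm _ (Fintype.card (V →ₗ[ZMod p] (Fin r → ZMod p)))]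
  exact Nat.add_le_add_left (Nat.mul_le_mul_left _ (Nat.sub_le _ _)) _

/-- `c_p ≤ 1` (from `J(p) ≥ 1/p`). [cite: FoxLovasz2017, §1] -/
theorem foxLovaszExponent_le_one {q : ℕ} (hq : 2 ≤ q) : foxLovaszExponent q ≤ 1 := by
  have hq0 : (0 : ℝ) < q := by exact_mod_cast (show 0 < q by omega)
  have hq1 : (1 : ℝ) < q := by exact_mod_cast (show 1 < q by omega)
  have hlogq : 0 < Real.log q := Real.log_pos hq1
  have hJ : 1 / (q : ℝ) ≤ bccgnsuJ q := one_div_le_bccgnsuJ (by omega)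
  have h := Real.log_le_log (by positivity) hJ
  rw [one_div, Real.log_inv] at h
  rw [foxLovaszExponent, div_le_one hlogq]
  linarith

/-- `0 < J(p) ≤ 1`. [cite: BlasiakChurchCohnGrochowNaslundSawinUmans2017, (4.11)] -/
theorem bccgnsuJ_le_one {q : ℕ} (hq : 2 ≤ q) : bccgnsuJ q ≤ 1 :=
  (bccgnsuJ_le_exp_neg_delta hq).trans (Real.exp_le_one_iff.2 (by linarith [bccgnsuDelta_pos]))

/-- `J(p)^d / p^d = (p^d)^{−(1+c_p)}` (since `J(p) = p^{−c_p}`). [cite: FoxLovasz2017, Lemma 5 (proof)] -/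
theorem bccgnsuJ_pow_div_pow {q : ℕ} (hq : 2 ≤ q) (d : ℕ) :
    bccgnsuJ q ^ d / (q : ℝ) ^ d = ((q : ℝ) ^ d) ^ (-(1 + foxLovaszExponent q)) := by
  have hq0 : (0 : ℝ) < q := by exact_mod_cast (show 0 < q by omega)
  have h1 : bccgnsuJ q ^ d = (q : ℝ) ^ (-foxLovaszExponent q * d) := by
    rw [← rpow_neg_foxLovaszExponent hq, Real.rpow_mul hq0.le, Real.rpow_natCast]
  have h2 : (q : ℝ) ^ d = (q : ℝ) ^ (d : ℝ) := (Real.rpow_natCast _ _).symm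
  rw [h1, h2, ← Real.rpow_sub hq0, ← Real.rpow_mul hq0.le]
  congr 1; ring

/-- **Lemma 5** (Fox–Lovász 2017), random-kernel version with the BCCGNSU constant: in a generic
configuration (`(G1)`: the two free vertices of a triangle are linearly independent; `(G2')`: a
triangle is determined by the membership of its vertices in the span of another) in which every
vertex lies in at most `ρN` triangles, `0 < ρ ≤ 1/(5p³)`, the number of triangles is at most
`211 p² ρ^{1+c_p} N²` (paper: `125 p² ρ^{1+c_p}`). [cite: FoxLovasz2017, Lemma 5] -/
theorem lemma5 {X Y Z : Finset V}
    (hG1 : ∀ t ∈ Tri[X, Y, Z], LinearIndependent (ZMod p) ![t.1, t.2])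
    (hG2 : ∀ t ∈ Tri[X, Y, Z], ∀ t' ∈ Tri[X, Y, Z], t'.1 ∈ Submodule.span (ZMod p) {t.1, t.2} →
      t'.2 ∈ Submodule.span (ZMod p) {t.1, t.2} → t' = t)
    {ρ : ℝ} (hρ0 : 0 < ρ) (hρ : ρ ≤ 1 / (5 * (p : ℝ) ^ 3))
    (hdeg : ∀ t ∈ Tri[X, Y, Z],
      ((((Tri[X, Y, Z]).filter fun t' : V × V => t'.1 = t.1).card : ℕ) : ℝ) ≤ ρ * Fintype.card V ∧
      ((((Tri[X, Y, Z]).filter fun t' : V × V => t'.2 = t.2).card : ℕ) : ℝ) ≤ ρ * Fintype.card V ∧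
      ((((Tri[X, Y, Z]).filter fun t' : V × V => t'.1 + t'.2 = t.1 + t.2).card : ℕ) : ℝ) ≤
        ρ * Fintype.card V) :
    (((Tri[X, Y, Z]).card : ℕ) : ℝ) ≤
      211 * (p : ℝ) ^ 2 * ρ ^ (1 + foxLovaszExponent p) * (Fintype.card V : ℝ) ^ 2 := by
  classical
  have hp2 : 2 ≤ p := hp.out.two_le
  have hp1 : 1 < p := hp.out.one_lt
  have hp0 : (0 : ℝ) < p := by exact_mod_cast hp.out.pos
  have hp1R : (1 : ℝ) < p := by exact_mod_cast hp1
  have hc0 : 0 < foxLovaszExponent p := foxLovaszExponent_pos hp2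
  have hc1 : foxLovaszExponent p ≤ 1 := foxLovaszExponent_le_one hp2
  have hNpos : 0 < Fintype.card V := Fintype.card_pos
  have hN0 : (0 : ℝ) < Fintype.card V := by exact_mod_cast hNpos
  -- trivial when there is no triangle
  rcases Nat.eq_zero_or_pos (Tri[X, Y, Z]).card with hT0 | hTpos
  · rw [hT0, Nat.cast_zero]; positivity
  -- `1 ≤ ρ N`
  have hρN : 1 ≤ ρ * Fintype.card V := by
    obtain ⟨t₀, ht₀⟩ := card_pos.1 hTpos
    have h1 : 1 ≤ ((Tri[X, Y, Z]).filter fun t' : V × V => t'.1 = t₀.1).card :=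
      card_pos.2 ⟨t₀, mem_filter.2 ⟨ht₀, rfl⟩⟩
    exact le_trans (by exact_mod_cast h1) (hdeg t₀ ht₀).1
  -- the dimension `n`, `N = p ^ n`
  haveI : Module.Finite (ZMod p) V := Module.Finite.of_finite
  obtain ⟨n, hn⟩ : ∃ n, n = Module.finrank (ZMod p) V := ⟨_, rfl⟩
  have hNpn : Fintype.card V = p ^ n := by
    rw [hn, Module.card_eq_pow_finrank (K := ZMod p) (V := V), ZMod.card]
  -- the integer degree bound `D = ⌊ρN⌋`
  obtain ⟨D, hD⟩ : ∃ D, D = ⌊ρ * Fintype.card V⌋₊ := ⟨_, rfl⟩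
  have hDle : (D : ℝ) ≤ ρ * Fintype.card V := hD ▸ Nat.floor_le (by positivity)
  have hdegD : ∀ t ∈ Tri[X, Y, Z],
      ((Tri[X, Y, Z]).filter fun t' : V × V => t'.1 = t.1).card ≤ D ∧
      ((Tri[X, Y, Z]).filter fun t' : V × V => t'.2 = t.2).card ≤ D ∧
      ((Tri[X, Y, Z]).filter fun t' : V × V => t'.1 + t'.2 = t.1 + t.2).card ≤ D := fun t ht =>
    ⟨hD ▸ Nat.le_floor (hdeg t ht).1, hD ▸ Nat.le_floor (hdeg t ht).2.1,
      hD ▸ Nat.le_floor (hdeg t ht).2.2⟩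
  -- the dimension `d` with `p^d ≤ 1/(5ρ) < p^(d+1)`, `3 ≤ d < n`
  obtain ⟨m₀, hm₀⟩ : ∃ m₀, m₀ = ⌊1 / (5 * ρ)⌋₊ := ⟨_, rfl⟩
  obtain ⟨d, hd⟩ : ∃ d, d = Nat.log p m₀ := ⟨_, rfl⟩
  have h5ρ : 0 < 5 * ρ := by positivity
  have hp3m₀ : p ^ 3 ≤ m₀ := by
    rw [hm₀]
    refine Nat.le_floor ?_
    rw [Nat.cast_pow, le_div_iff₀ h5ρ]
    have h : ρ * (5 * (p : ℝ) ^ 3) ≤ 1 := by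
      rw [← le_div_iff₀ (by positivity)]; exact hρ
    linarith
  have hm₀pos : m₀ ≠ 0 := by
    have : 0 < p ^ 3 := pow_pos hp.out.pos 3
    omega
  have hd3 : 3 ≤ d := hd ▸ Nat.le_log_of_pow_le hp1 hp3m₀
  have hPle : (p : ℝ) ^ d ≤ 1 / (5 * ρ) := by
    have h1 : ((p ^ d : ℕ) : ℝ) ≤ m₀ := by exact_mod_cast hd ▸ Nat.pow_log_le_self p hm₀pos
    rw [Nat.cast_pow] at h1
    exact h1.trans (hm₀ ▸ Nat.floor_le (by positivity))
  have hPlt : 1 / (5 * ρ) < (p : ℝ) ^ (d + 1) := by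
    have h1 : m₀ + 1 ≤ p ^ (d + 1) := hd ▸ Nat.lt_pow_succ_log_self hp1 m₀
    have h2 : 1 / (5 * ρ) < (m₀ : ℝ) + 1 := hm₀ ▸ Nat.lt_floor_add_one _
    have h3 : ((m₀ + 1 : ℕ) : ℝ) ≤ ((p ^ (d + 1) : ℕ) : ℝ) := by exact_mod_cast h1
    push_cast at h3
    linarith
  have hdn : d < n := by
    have h1 : (p : ℝ) ^ d < (p : ℝ) ^ n := by
      have h2 : 1 / (5 * ρ) ≤ Fintype.card V / 5 := by
        rw [div_le_div_iff₀ h5ρ (by norm_num : (0 : ℝ) < 5)]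
        nlinarith
      have h3 : ((Fintype.card V : ℕ) : ℝ) = (p : ℝ) ^ n := by rw [hNpn]; push_cast; ring
      linarith
    exact (pow_lt_pow_iff_right₀ hp1R).1 h1
  -- the codomain `W = 𝔽_p^r`, `r = n - d`, `|W| p^d = N`
  obtain ⟨r, hr⟩ : ∃ r, r = n - d := ⟨_, rfl⟩
  have hwP : (Fintype.card (Fin r → ZMod p) : ℝ) * (p : ℝ) ^ d = Fintype.card V := by
    rw [Fintype.card_fun, ZMod.card, Fintype.card_fin, hNpn]
    push_cast
    rw [← pow_add]
    congr 1; omega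
  -- the random linear maps `f : V → W`
  haveI : Fintype (V →ₗ[ZMod p] (Fin r → ZMod p)) :=
    Fintype.ofInjective (fun f : V →ₗ[ZMod p] (Fin r → ZMod p) => (f : V → Fin r → ZMod p))
      DFunLike.coe_injective
  have hΩpos : 0 < Fintype.card (V →ₗ[ZMod p] (Fin r → ZMod p)) := Fintype.card_pos
  -- (i) lower bound: `T Ω w ≤ (Σ_f #good) w³ + 3 D T Ω`
  have hlow : (Tri[X, Y, Z]).card * (Fintype.card (V →ₗ[ZMod p] (Fin r → ZMod p)) *
      Fintype.card (Fin r → ZMod p)) ≤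
      (∑ f : V →ₗ[ZMod p] (Fin r → ZMod p), (Good[f, X, Y, Z]).card) *
          Fintype.card (Fin r → ZMod p) ^ 3 +
        (Tri[X, Y, Z]).card * (3 * D * Fintype.card (V →ₗ[ZMod p] (Fin r → ZMod p))) := by
    have h1 : ∑ _t ∈ Tri[X, Y, Z], Fintype.card (V →ₗ[ZMod p] (Fin r → ZMod p)) *
        Fintype.card (Fin r → ZMod p) ≤ ∑ t ∈ Tri[X, Y, Z],
        ((univ.filter fun f : V →ₗ[ZMod p] (Fin r → ZMod p) => t ∈ Good[f, X, Y, Z]).card *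
          Fintype.card (Fin r → ZMod p) ^ 3 +
          3 * D * Fintype.card (V →ₗ[ZMod p] (Fin r → ZMod p))) :=
      sum_le_sum fun t ht => card_mul_le_card_good hG1 hG2 hdegD ht
    rw [sum_const, smul_eq_mul, sum_add_distrib, sum_const, smul_eq_mul, ← sum_mul] at h1
    have h2 : ∑ t ∈ Tri[X, Y, Z],
        (univ.filter fun f : V →ₗ[ZMod p] (Fin r → ZMod p) => t ∈ Good[f, X, Y, Z]).card =
        ∑ f : V →ₗ[ZMod p] (Fin r → ZMod p), (Good[f, X, Y, Z]).card := by
      rw [sum_congr rfl fun t _ => card_filter _ _, sum_comm]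
      refine sum_congr rfl fun f _ => ?_
      rw [← card_filter, filter_mem_eq_inter, inter_eq_right.2]
      exact (filter_subset _ _).trans (filter_subset _ _)
    rw [h2] at h1
    exact h1
  -- (ii) upper bound: `Σ_f #good ≤ 3 J^d Σ_f |ker f|`
  have hJ0 : 0 < bccgnsuJ p := bccgnsuJ_pos (by omega)
  have hJ1 : bccgnsuJ p ≤ 1 := bccgnsuJ_le_one hp2
  have hup : (((∑ f : V →ₗ[ZMod p] (Fin r → ZMod p), (Good[f, X, Y, Z]).card : ℕ)) : ℝ) ≤
      3 * bccgnsuJ p ^ d * (((∑ f : V →ₗ[ZMod p] (Fin r → ZMod p),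
        (univ.filter fun v : V => f v = 0).card : ℕ)) : ℝ) := by
    push_cast
    rw [mul_sum]
    refine sum_le_sum fun f _ => ?_
    have hdk : d ≤ Module.finrank (ZMod p) (LinearMap.ker f) := by
      have h1 := LinearMap.finrank_range_add_finrank_ker f
      have h2 : Module.finrank (ZMod p) (LinearMap.range f) ≤ r :=
        (Submodule.finrank_le _).trans_eq (Module.finrank_fin_fun (ZMod p))
      omega
    calc ((Good[f, X, Y, Z]).card : ℝ)
        ≤ 3 * (univ.filter fun v : V => f v = 0).card *
            bccgnsuJ p ^ Module.finrank (ZMod p) (LinearMap.ker f) := card_good_le f X Y Z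
      _ ≤ 3 * (univ.filter fun v : V => f v = 0).card * bccgnsuJ p ^ d :=
          mul_le_mul_of_nonneg_left (pow_le_pow_of_le_one hJ0.le hJ1 hdk) (by positivity)
      _ = 3 * bccgnsuJ p ^ d * (univ.filter fun v : V => f v = 0).card := by ring
  -- (iii) the expected kernel size
  have hker := sum_card_ker_mul_le (p := p) (V := V) (r := r)
  -- combine (i)–(iii) in `ℝ`
  set T : ℝ := (((Tri[X, Y, Z]).card : ℕ) : ℝ) with hT
  set N : ℝ := ((Fintype.card V : ℕ) : ℝ) with hN
  set Ω : ℝ := ((Fintype.card (V →ₗ[ZMod p] (Fin r → ZMod p)) : ℕ) : ℝ) with hΩ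
  set w : ℝ := ((Fintype.card (Fin r → ZMod p) : ℕ) : ℝ) with hw
  set P : ℝ := (p : ℝ) ^ d with hP
  set J : ℝ := bccgnsuJ p with hJ
  set SG : ℝ := (((∑ f : V →ₗ[ZMod p] (Fin r → ZMod p), (Good[f, X, Y, Z]).card : ℕ)) : ℝ)
    with hSG
  set SK : ℝ := (((∑ f : V →ₗ[ZMod p] (Fin r → ZMod p),
    (univ.filter fun v : V => f v = 0).card : ℕ)) : ℝ) with hSK
  have hΩ0 : 0 < Ω := by rw [hΩ]; exact_mod_cast hΩpos
  have hP0 : 0 < P := by rw [hP]; positivity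
  have hP8 : 8 ≤ P := by
    rw [hP]
    calc (8 : ℝ) = 2 ^ 3 := by norm_num
      _ ≤ (p : ℝ) ^ 3 := by gcongr; exact_mod_cast hp2
      _ ≤ (p : ℝ) ^ d := pow_le_pow_right₀ hp1R.le hd3
  have hwN : w * P = N := hwP
  have hw0 : 0 < w := by
    have : 0 < w * P := by rw [hwN]; exact hN0
    exact pos_of_mul_pos_left this hP0.le  -- hmm
  have hlowR : T * (Ω * w) ≤ SG * w ^ 3 + T * (3 * D * Ω) := by
    have h := hlow
    rw [hT, hΩ, hw, hSG]
    exact_mod_cast h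
  have hkerR : SK * w ≤ Ω * (w + N) := by
    rw [hSK, hw, hΩ, hN]
    exact_mod_cast hker
  have hJd0 : 0 ≤ J ^ d := pow_nonneg hJ0.le d
  -- `T w ≤ 3 J^d (w + N) w² + 3 D T`
  have hstep1 : T * w ≤ 3 * J ^ d * (w + N) * w ^ 2 + 3 * D * T := by
    have h3 : SG * w ^ 3 ≤ 3 * J ^ d * (Ω * (w + N)) * w ^ 2 := by
      calc SG * w ^ 3 ≤ (3 * J ^ d * SK) * w ^ 3 := by gcongr
        _ = 3 * J ^ d * (SK * w) * w ^ 2 := by ring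
        _ ≤ 3 * J ^ d * (Ω * (w + N)) * w ^ 2 := by gcongr
    have h4 : Ω * (T * w) ≤ Ω * (3 * J ^ d * (w + N) * w ^ 2 + 3 * D * T) := by
      calc Ω * (T * w) = T * (Ω * w) := by ring
        _ ≤ SG * w ^ 3 + T * (3 * D * Ω) := hlowR
        _ ≤ 3 * J ^ d * (Ω * (w + N)) * w ^ 2 + T * (3 * D * Ω) := by gcongr
        _ = Ω * (3 * J ^ d * (w + N) * w ^ 2 + 3 * D * T) := by ring
    exact le_of_mul_le_mul_left h4 hΩ0
  -- `D ≤ ρ N ≤ w / 5`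
  have hDw : (D : ℝ) ≤ w / 5 := by
    have h1 : ρ * P ≤ 1 / 5 := by
      have := hPle
      rw [le_div_iff₀ h5ρ] at this
      linarith
    calc (D : ℝ) ≤ ρ * N := hDle
      _ = w * (ρ * P) := by rw [← hwN]; ring
      _ ≤ w * (1 / 5) := by gcongr
      _ = w / 5 := by ring
  -- `T ≤ (15/2) J^d (w + N) w`
  have hstep2 : T ≤ 15 / 2 * J ^ d * (w + N) * w := by
    have hT0 : 0 ≤ T := by rw [hT]; positivity
    have h1 : 3 * (D : ℝ) * T ≤ 3 / 5 * w * T := by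
      refine mul_le_mul_of_nonneg_right ?_ hT0
      linarith
    have h2 : 2 / 5 * (T * w) ≤ 3 * J ^ d * (w + N) * w ^ 2 := by linarith
    have h3 : w * T ≤ w * (15 / 2 * J ^ d * (w + N) * w) := by linarith
    exact le_of_mul_le_mul_left h3 hw0
  -- `(w + N) w = N² (1 + 1/P) / P`-type rewriting through `Q = J^d / P`
  have hQ : J ^ d / P < 25 * (p : ℝ) ^ 2 * ρ ^ (1 + foxLovaszExponent p) := by
    rw [hJ, hP, bccgnsuJ_pow_div_pow hp2 d]
    have h5pρ : 0 < 5 * (p : ℝ) * ρ := by positivity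
    have hx : 1 / (5 * (p : ℝ) * ρ) < (p : ℝ) ^ d := by
      rw [div_lt_iff₀ h5pρ]
      have := hPlt
      rw [div_lt_iff₀ h5ρ, pow_succ] at this
      linarith
    have hneg : -(1 + foxLovaszExponent p) < 0 := by linarith
    calc ((p : ℝ) ^ d) ^ (-(1 + foxLovaszExponent p))
        < (1 / (5 * (p : ℝ) * ρ)) ^ (-(1 + foxLovaszExponent p)) :=
          Real.rpow_lt_rpow_of_neg (by positivity) hx hneg
      _ = (5 * (p : ℝ) * ρ) ^ (1 + foxLovaszExponent p) := by
          rw [one_div, Real.inv_rpow h5pρ.le, Real.rpow_neg h5pρ.le, inv_inv]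
      _ = (5 * (p : ℝ)) ^ (1 + foxLovaszExponent p) * ρ ^ (1 + foxLovaszExponent p) :=
          Real.mul_rpow (by positivity) hρ0.le
      _ ≤ (5 * (p : ℝ)) ^ (2 : ℝ) * ρ ^ (1 + foxLovaszExponent p) :=
          mul_le_mul_of_nonneg_right (Real.rpow_le_rpow_of_exponent_le
            (by linarith only [hp1R]) (by linarith only [hc1])) (Real.rpow_nonneg hρ0.le _)
      _ = 25 * (p : ℝ) ^ 2 * ρ ^ (1 + foxLovaszExponent p) := by
          rw [Real.rpow_two]; ring
  have hρc0 : 0 ≤ ρ ^ (1 + foxLovaszExponent p) := Real.rpow_nonneg hρ0.le _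
  -- final algebra
  have hfin : 15 / 2 * J ^ d * (w + N) * w ≤ 135 / 16 * (J ^ d / P) * N ^ 2 := by
    have h1 : 15 / 2 * J ^ d * (w + N) * w = 15 / 2 * (J ^ d / P) * N ^ 2 * (1 / P + 1) := by
      field_simp
      rw [← hwN]
      ring
    rw [h1]
    have hQ0 : 0 ≤ J ^ d / P := div_nonneg hJd0 hP0.le
    have h2 : 1 / P + 1 ≤ 9 / 8 := by
      rw [div_add_one hP0.ne', div_le_div_iff₀ hP0 (by norm_num)]
      linarith only [hP8]
    have hN2 : 0 ≤ N ^ 2 := sq_nonneg N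
    calc 15 / 2 * (J ^ d / P) * N ^ 2 * (1 / P + 1)
        ≤ 15 / 2 * (J ^ d / P) * N ^ 2 * (9 / 8) :=
          mul_le_mul_of_nonneg_left h2 (by positivity)
      _ = 135 / 16 * (J ^ d / P) * N ^ 2 := by ring
  calc T ≤ 15 / 2 * J ^ d * (w + N) * w := hstep2
    _ ≤ 135 / 16 * (J ^ d / P) * N ^ 2 := hfin
    _ ≤ 135 / 16 * (25 * (p : ℝ) ^ 2 * ρ ^ (1 + foxLovaszExponent p)) * N ^ 2 := by
        gcongr
    _ = 3375 / 16 * ((p : ℝ) ^ 2 * ρ ^ (1 + foxLovaszExponent p) * N ^ 2) := by ring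
    _ ≤ 211 * ((p : ℝ) ^ 2 * ρ ^ (1 + foxLovaszExponent p) * N ^ 2) :=
        mul_le_mul_of_nonneg_right (by norm_num) (by positivity)
    _ = 211 * (p : ℝ) ^ 2 * ρ ^ (1 + foxLovaszExponent p) * N ^ 2 := by ring

/-! ### Lemma 6: iterated removal of high-degree vertices -/

/-- **The potential drops by one at each removal** (replaces the dyadic counting in the proof of
Lemma 6): if from `T_b > 0` triangles we pass to `T_a = T_b − g` by deleting a vertex of degree
`g ≥ 2 log²(Φ/T_b) T_b / m`, and `log(Φ/T_b) ≥ 1`, then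
`m / log(Φ/T_a) + 1 ≤ m / log(Φ/T_b)` (with Lean's `m / log(Φ/0) = 0`). Only `1 − 1/x ≤ log x`
is used. [cite: FoxLovasz2017, Lemma 6 (proof)] -/
theorem potential_step {m Φ Tb Ta g : ℝ} (hm : 0 < m) (hΦ : 0 < Φ) (hTb : 0 < Tb) (hTa : 0 ≤ Ta)
    (hg : Ta + g = Tb) (hL : 1 ≤ Real.log (Φ / Tb))
    (hdeg : 2 * Real.log (Φ / Tb) ^ 2 * Tb / m ≤ g) :
    m / Real.log (Φ / Ta) + 1 ≤ m / Real.log (Φ / Tb) := by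
  set w := Real.log (Φ / Tb) with hw
  have hw0 : 0 < w := by linarith
  by_cases hTa0 : Ta = 0
  · rw [hTa0, div_zero, Real.log_zero, div_zero, zero_add]
    have hgT : g = Tb := by rw [hTa0, zero_add] at hg; exact hg
    rw [hgT, div_le_iff₀ hm] at hdeg
    have h1 : 2 * w ^ 2 ≤ m := le_of_mul_le_mul_right (by linarith) hTb
    rw [le_div_iff₀ hw0]
    nlinarith
  · have hTa' : 0 < Ta := lt_of_le_of_ne hTa (Ne.symm hTa0)
    have hg0 : 0 < g := by
      have : 0 < 2 * w ^ 2 * Tb / m := by positivity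
      linarith
    have hTab : Ta < Tb := by linarith
    -- `log (Φ / Ta) = w + s`, `s = log (Tb / Ta) ≥ 0`
    have hLa : Real.log (Φ / Ta) = w + Real.log (Tb / Ta) := by
      rw [hw, ← Real.log_mul (div_pos hΦ hTb).ne' (div_pos hTb hTa').ne']
      congr 1
      field_simp
    set s := Real.log (Tb / Ta) with hs
    have hs0 : 0 ≤ s := Real.log_nonneg ((one_le_div hTa').2 hTab.le)
    -- `u = g / Tb ∈ (0, 1]`, `u ≤ s`
    have hus : g / Tb ≤ s := by
      have h := Real.one_sub_inv_le_log_of_pos (div_pos hTb hTa')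
      rw [inv_div] at h
      have h' : g / Tb = 1 - Ta / Tb := by
        field_simp
        linarith
      rw [h']; exact h
    have hu1 : g / Tb ≤ 1 := by rw [div_le_one hTb]; linarith
    have hu0 : 0 < g / Tb := div_pos hg0 hTb
    -- key: `u (w + s) ≤ 2 w s`
    have key : g / Tb * (w + s) ≤ 2 * w * s := by
      rcases le_or_gt s w with hsw | hsw
      · calc g / Tb * (w + s) ≤ s * (w + s) :=
            mul_le_mul_of_nonneg_right hus (by linarith)
          _ ≤ s * (w + w) := mul_le_mul_of_nonneg_left (by linarith) hs0
          _ = 2 * w * s := by ring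
      · calc g / Tb * (w + s) ≤ 1 * (w + s) :=
            mul_le_mul_of_nonneg_right hu1 (by linarith)
          _ ≤ 2 * w * s := by nlinarith
    -- `m ≥ 2 w² Tb / g`
    have hm' : 2 * w ^ 2 * Tb / g ≤ m := by
      rw [div_le_iff₀ hg0]
      rw [div_le_iff₀ hm] at hdeg
      linarith [mul_comm m g]
    -- `w (w + s) ≤ m s`
    have hws : w * (w + s) ≤ m * s := by
      have h1 : w * (w + s) * (g / Tb) ≤ 2 * w ^ 2 * s := by nlinarith [key]
      have h2 : w * (w + s) ≤ 2 * w ^ 2 * s / (g / Tb) := by rw [le_div_iff₀ hu0]; exact h1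
      calc w * (w + s) ≤ 2 * w ^ 2 * s / (g / Tb) := h2
        _ = (2 * w ^ 2 * Tb / g) * s := by field_simp
        _ ≤ m * s := mul_le_mul_of_nonneg_right hm' hs0
    rw [hLa]
    have hws0 : 0 < w + s := by linarith
    rw [div_add_one hws0.ne', div_le_div_iff₀ hws0 hw0]
    nlinarith [hws]

/-- The removal threshold `θ(T) = 2 log²(N²/T) T / m` of the (modified) proof of Lemma 6. -/
local notation3 "θ[" m ", " T "]" =>
  2 * Real.log ((Fintype.card V : ℝ) ^ 2 / T) ^ 2 * T / m

/-- The potential `m / log(N²/T)` controlling the number of removed vertices. -/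
local notation3 "Pot[" m ", " T "]" => m / Real.log ((Fintype.card V : ℝ) ^ 2 / T)

/-- Terminal configurations of the removal process: every vertex has degree `< θ(T)`. -/
local notation3 (prettyPrint := false) "Terminal[" m ", " A ", " B ", " C "]" =>
  ∀ t ∈ Tri[A, B, C],
    ((((Tri[A, B, C]).filter fun t' : V × V => t'.1 = t.1).card : ℕ) : ℝ) <
        θ[m, (((Tri[A, B, C]).card : ℕ) : ℝ)] ∧
      ((((Tri[A, B, C]).filter fun t' : V × V => t'.2 = t.2).card : ℕ) : ℝ) <
        θ[m, (((Tri[A, B, C]).card : ℕ) : ℝ)] ∧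
      ((((Tri[A, B, C]).filter fun t' : V × V => t'.1 + t'.2 = t.1 + t.2).card : ℕ) : ℝ) <
        θ[m, (((Tri[A, B, C]).card : ℕ) : ℝ)]

omit [Module (ZMod p) V] in
/-- **The removal process** (proof of Lemma 6: "we do this by removing bad points from the sets one
at a time"): from any `(A, B, C)` with `e · T ≤ N²` one reaches, by deleting vertices of degree
`≥ θ(T) = 2 log²(N²/T) T/m` one at a time, a terminal sub-configuration, having deleted at most
`Pot(T_start) − Pot(T_end)` vertices, `Pot(T) = m / log(N²/T)`.
[cite: FoxLovasz2017, Lemma 6 (proof)] -/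
theorem removal_process {m : ℝ} (hm : 0 < m) :
    ∀ (n : ℕ) (A B C : Finset V), A.card + B.card + C.card = n →
      Real.exp 1 * ((Tri[A, B, C]).card : ℝ) ≤ (Fintype.card V : ℝ) ^ 2 →
      ∃ A' ⊆ A, ∃ B' ⊆ B, ∃ C' ⊆ C, Terminal[m, A', B', C'] ∧
        ((A.card + B.card + C.card : ℕ) : ℝ) - ((A'.card + B'.card + C'.card : ℕ) : ℝ) ≤
          Pot[m, (((Tri[A, B, C]).card : ℕ) : ℝ)] - Pot[m, (((Tri[A', B', C']).card : ℕ) : ℝ)] := by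
  intro n
  induction n using Nat.strong_induction_on with
  | _ n ih =>
  intro A B C hn hT
  by_cases hterm : Terminal[m, A, B, C]
  · exact ⟨A, Subset.rfl, B, Subset.rfl, C, Subset.rfl, hterm, by simp⟩
  · have hN : (0 : ℝ) < Fintype.card V := by exact_mod_cast Fintype.card_pos
    -- `Tri` is nonempty, since the empty configuration is terminal
    have hTpos : 0 < (Tri[A, B, C]).card := by
      rw [card_pos]
      by_contra h0
      rw [not_nonempty_iff_eq_empty] at h0
      exact hterm fun t ht => absurd ht (by rw [h0]; exact notMem_empty t)
    -- a generic removal step followed by the induction hypothesis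
    have step : ∀ A' ⊆ A, ∀ B' ⊆ B, ∀ C' ⊆ C, ∀ g : ℕ,
        A'.card + B'.card + C'.card + 1 = A.card + B.card + C.card →
        (Tri[A', B', C']).card + g = (Tri[A, B, C]).card →
        θ[m, (((Tri[A, B, C]).card : ℕ) : ℝ)] ≤ g →
        ∃ A'' ⊆ A, ∃ B'' ⊆ B, ∃ C'' ⊆ C, Terminal[m, A'', B'', C''] ∧
          ((A.card + B.card + C.card : ℕ) : ℝ) - ((A''.card + B''.card + C''.card : ℕ) : ℝ) ≤
            Pot[m, (((Tri[A, B, C]).card : ℕ) : ℝ)] -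
              Pot[m, (((Tri[A'', B'', C'']).card : ℕ) : ℝ)] := by
      intro A' hA' B' hB' C' hC' g hcard hTg hθ
      have hT' : Real.exp 1 * ((Tri[A', B', C']).card : ℝ) ≤ (Fintype.card V : ℝ) ^ 2 := by
        refine le_trans (mul_le_mul_of_nonneg_left ?_ (Real.exp_pos 1).le) hT
        exact_mod_cast (show (Tri[A', B', C']).card ≤ (Tri[A, B, C]).card by omega)
      obtain ⟨A'', hA'', B'', hB'', C'', hC'', hterm'', hacc⟩ :=
        ih (A'.card + B'.card + C'.card) (by omega) A' B' C' rfl hT'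
      refine ⟨A'', hA''.trans hA', B'', hB''.trans hB', C'', hC''.trans hC', hterm'', ?_⟩
      have hTR : (0 : ℝ) < (Tri[A, B, C]).card := by exact_mod_cast hTpos
      have hL : 1 ≤ Real.log ((Fintype.card V : ℝ) ^ 2 / (Tri[A, B, C]).card) := by
        rw [← Real.log_exp 1]
        refine Real.log_le_log (Real.exp_pos 1) ?_
        rw [le_div_iff₀ hTR]
        exact hT
      have hstep := potential_step (Φ := (Fintype.card V : ℝ) ^ 2)
        (Tb := (((Tri[A, B, C]).card : ℕ) : ℝ)) (Ta := (((Tri[A', B', C']).card : ℕ) : ℝ))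
        (g := (g : ℝ)) hm (by positivity) hTR (by positivity) (by exact_mod_cast hTg) hL hθ
      have hcardR : ((A.card + B.card + C.card : ℕ) : ℝ) =
          ((A'.card + B'.card + C'.card : ℕ) : ℝ) + 1 := by
        rw [← hcard]; push_cast; ring
      rw [hcardR]
      linarith [hacc, hstep]
    -- find a vertex of large degree
    simp only [not_forall, not_and_or, not_lt, exists_prop] at hterm
    obtain ⟨t, ht, hbad⟩ := hterm
    obtain ⟨htA, htB, htC⟩ := mem_tri.1 ht
    rcases hbad with h1 | h2 | h3
    · -- remove `t.1` from `A`
      refine step (A.erase t.1) (erase_subset _ _) B Subset.rfl C Subset.rfl _ ?_ ?_ h1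
      · rw [card_erase_of_mem htA]
        have := card_pos.2 ⟨t.1, htA⟩
        omega
      · have hfilt : Tri[A.erase t.1, B, C] =
            (Tri[A, B, C]).filter fun t' : V × V => ¬ (t'.1 = t.1) := by
          ext t'
          simp only [mem_filter, mem_product, mem_erase]
          tauto
        rw [hfilt, add_comm, card_filter_add_card_filter_not]
    · -- remove `t.2` from `B`
      refine step A Subset.rfl (B.erase t.2) (erase_subset _ _) C Subset.rfl _ ?_ ?_ h2
      · rw [card_erase_of_mem htB]
        have := card_pos.2 ⟨t.2, htB⟩
        omega
      · have hfilt : Tri[A, B.erase t.2, C] =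
            (Tri[A, B, C]).filter fun t' : V × V => ¬ (t'.2 = t.2) := by
          ext t'
          simp only [mem_filter, mem_product, mem_erase]
          tauto
        rw [hfilt, add_comm, card_filter_add_card_filter_not]
    · -- remove `-(t.1 + t.2)` from `C`
      refine step A Subset.rfl B Subset.rfl (C.erase (-(t.1 + t.2))) (erase_subset _ _) _ ?_ ?_ h3
      · rw [card_erase_of_mem htC]
        have := card_pos.2 ⟨-(t.1 + t.2), htC⟩
        omega
      · have hfilt : Tri[A, B, C.erase (-(t.1 + t.2))] =
            (Tri[A, B, C]).filter fun t' : V × V => ¬ (t'.1 + t'.2 = t.1 + t.2) := by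
          ext t'
          simp only [mem_filter, mem_product, mem_erase, ne_eq, neg_inj]
          tauto
        rw [hfilt, add_comm, card_filter_add_card_filter_not]

/-- **Monotonicity of `δ ↦ δ^c log(1/δ)^b` on `(0, e^{−b/c}]`** (the condition "`β^{c_p} g(β)^{1+c_p}`
decreases as `β` decreases" on `g(β) = log²(1/β)` in Lemma 6), proved without calculus from
`1 + x ≤ eˣ`. [cite: FoxLovasz2017, Lemma 6] -/
theorem rpow_mul_log_rpow_le {c b δ₁ δ₂ : ℝ} (hc : 0 < c) (hb : 0 < b) (h0 : 0 < δ₁) (h12 : δ₁ ≤ δ₂)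
    (h2 : δ₂ ≤ Real.exp (-(b / c))) :
    δ₁ ^ c * Real.log (1 / δ₁) ^ b ≤ δ₂ ^ c * Real.log (1 / δ₂) ^ b := by
  have h02 : 0 < δ₂ := lt_of_lt_of_le h0 h12
  set u₁ := Real.log (1 / δ₁) with hu₁
  set u₂ := Real.log (1 / δ₂) with hu₂
  have hu₂b : b / c ≤ u₂ := by
    rw [hu₂, ← Real.log_exp (b / c)]
    refine Real.log_le_log (Real.exp_pos _) ?_
    rw [le_one_div (Real.exp_pos _) h02, one_div, ← Real.exp_neg]
    exact h2
  have hbc : 0 < b / c := div_pos hb hc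
  have hu₂0 : 0 < u₂ := lt_of_lt_of_le hbc hu₂b
  have hu12 : u₂ ≤ u₁ := Real.log_le_log (by positivity) (one_div_le_one_div_of_le h0 h12)
  have hu₁0 : 0 < u₁ := lt_of_lt_of_le hu₂0 hu12
  -- `δᵢ ^ c = exp (-c uᵢ)`
  have hδ : ∀ {δ : ℝ}, 0 < δ → δ ^ c = Real.exp (-(c * Real.log (1 / δ))) := by
    intro δ hδ
    rw [Real.rpow_def_of_pos hδ, one_div, Real.log_inv]
    congr 1; ring
  rw [hδ h0, hδ h02, ← hu₁, ← hu₂]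
  -- `u₁^b ≤ u₂^b exp (c (u₁ - u₂))`
  have hratio : (u₁ / u₂) ^ b ≤ Real.exp (c * (u₁ - u₂)) := by
    have h1 : u₁ / u₂ ≤ Real.exp (u₁ / u₂ - 1) := by
      have := Real.add_one_le_exp (u₁ / u₂ - 1)
      linarith
    calc (u₁ / u₂) ^ b ≤ (Real.exp (u₁ / u₂ - 1)) ^ b :=
          Real.rpow_le_rpow (div_nonneg hu₁0.le hu₂0.le) h1 hb.le
      _ = Real.exp ((u₁ / u₂ - 1) * b) := by rw [← Real.exp_mul]
      _ ≤ Real.exp (c * (u₁ - u₂)) := by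
          rw [Real.exp_le_exp]
          have h3 : (u₁ / u₂ - 1) * b = (u₁ - u₂) * (b / u₂) := by
            field_simp
          rw [h3, mul_comm c]
          exact mul_le_mul_of_nonneg_left ((div_le_iff₀ hu₂0).2 (by
            calc b = b / c * c := by field_simp
              _ ≤ u₂ * c := mul_le_mul_of_nonneg_right hu₂b hc.le
              _ = c * u₂ := mul_comm _ _)) (by linarith)
  have hpow : u₁ ^ b ≤ u₂ ^ b * Real.exp (c * (u₁ - u₂)) := by
    have h1 : u₁ = u₂ * (u₁ / u₂) := by field_simp
    calc u₁ ^ b = (u₂ * (u₁ / u₂)) ^ b := by rw [← h1]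
      _ = u₂ ^ b * (u₁ / u₂) ^ b := Real.mul_rpow hu₂0.le (div_nonneg hu₁0.le hu₂0.le)
      _ ≤ u₂ ^ b * Real.exp (c * (u₁ - u₂)) :=
          mul_le_mul_of_nonneg_left hratio (Real.rpow_nonneg hu₂0.le _)
  calc Real.exp (-(c * u₁)) * u₁ ^ b
      ≤ Real.exp (-(c * u₁)) * (u₂ ^ b * Real.exp (c * (u₁ - u₂))) :=
        mul_le_mul_of_nonneg_left hpow (Real.exp_pos _).le
    _ = Real.exp (-(c * u₂)) * u₂ ^ b := by
        rw [mul_comm (u₂ ^ b), ← mul_assoc, ← Real.exp_add]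
        congr 2; ring

omit [Module (ZMod p) V] [Fintype V] in
/-- Triangle finsets are monotone in the three sets. [folklore] -/
theorem tri_mono {A B C X Y Z : Finset V} (hA : A ⊆ X) (hB : B ⊆ Y) (hC : C ⊆ Z) :
    Tri[A, B, C] ⊆ Tri[X, Y, Z] := by
  intro t ht
  obtain ⟨h1, h2, h3⟩ := mem_tri.1 ht
  exact mem_tri.2 ⟨hA h1, hB h2, hC h3⟩

omit [AddCommGroup V] [Module (ZMod p) V] [Fintype V] in
/-- For `A ⊆ image x` (`x` injective) the indices `i` with `x i ∈ A` are `|A|` in number.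
[folklore] -/
theorem card_filter_mem_of_subset_image {ι : Type} [Fintype ι] {x : ι → V}
    (hx : Function.Injective x) {A : Finset V} (hA : A ⊆ univ.image x) :
    (univ.filter fun i => x i ∈ A).card = A.card := by
  classical
  have h : (univ.filter fun i => x i ∈ A).image x = A := by
    ext a
    simp only [mem_image, mem_filter, mem_univ, true_and]
    constructor
    · rintro ⟨i, hi, rfl⟩; exact hi
    · intro ha
      obtain ⟨i, -, rfl⟩ := mem_image.1 (hA ha)
      exact ⟨i, ha, rfl⟩
  calc (univ.filter fun i => x i ∈ A).card = ((univ.filter fun i => x i ∈ A).image x).card :=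
      (card_image_of_injective _ hx).symm
    _ = A.card := by rw [h]

/-- **Lemma 6** (Fox–Lovász 2017), in the direct form produced by the potential argument and
Lemma 5: for `m ≥ 1` pairwise disjoint triangles `(xᵢ, yᵢ, zᵢ)` forming a generic configuration
`X = {xᵢ}, Y = {yᵢ}, Z = {zᵢ}` with `T₀ = δ₀N²` triangles, `δ₀ ≤ e^{−2(1+c_p)/c_p}`, one has
`ε^{1+c_p} ≤ 100 p⁶ δ₀^{c_p} log(1/δ₀)^{2(1+c_p)}` where `ε = m/N`
(paper: `ε ≤ (125p²)^{1/(1+c_p)} δ^{c_p/(1+c_p)} g(δ)`, `g = log²`). [cite: FoxLovasz2017, Lemma 6] -/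
theorem lemma6 {ι : Type} [Fintype ι] [Nonempty ι] {x y z : ι → V} (hx : Function.Injective x)
    (hy : Function.Injective y) (hz : Function.Injective z) (hsum : ∀ i, x i + y i + z i = 0)
    (hG1 : ∀ t ∈ Tri[univ.image x, univ.image y, univ.image z],
      LinearIndependent (ZMod p) ![t.1, t.2])
    (hG2 : ∀ t ∈ Tri[univ.image x, univ.image y, univ.image z],
      ∀ t' ∈ Tri[univ.image x, univ.image y, univ.image z],
      t'.1 ∈ Submodule.span (ZMod p) {t.1, t.2} → t'.2 ∈ Submodule.span (ZMod p) {t.1, t.2} →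
      t' = t)
    (hsmall : (((Tri[univ.image x, univ.image y, univ.image z]).card : ℕ) : ℝ) ≤
      Real.exp (-(2 * (1 + foxLovaszExponent p) / foxLovaszExponent p)) *
        (Fintype.card V : ℝ) ^ 2) :
    ((Fintype.card ι : ℝ) / Fintype.card V) ^ (1 + foxLovaszExponent p) ≤
      100 * (p : ℝ) ^ 6 *
        ((((Tri[univ.image x, univ.image y, univ.image z]).card : ℕ) : ℝ) /
            (Fintype.card V : ℝ) ^ 2) ^ foxLovaszExponent p *
        Real.log ((Fintype.card V : ℝ) ^ 2 /
            ((Tri[univ.image x, univ.image y, univ.image z]).card : ℕ)) ^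
          (2 * (1 + foxLovaszExponent p)) := by
  classical
  have hp2 : 2 ≤ p := hp.out.two_le
  have hp0 : (0 : ℝ) < p := by exact_mod_cast hp.out.pos
  have hp1R : (1 : ℝ) < p := by exact_mod_cast hp.out.one_lt
  set c := foxLovaszExponent p with hc
  have hc0 : 0 < c := hc ▸ foxLovaszExponent_pos hp2
  have hc1 : c ≤ 1 := hc ▸ foxLovaszExponent_le_one hp2
  set b : ℝ := 2 * (1 + c) with hb
  clear_value c b
  have hb0 : 0 < b := by rw [hb]; linarith
  have hbc : 4 ≤ b / c := by
    rw [hb, le_div_iff₀ hc0]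
    linarith only [hc1]
  set X := univ.image x with hX
  set Y := univ.image y with hY
  set Z := univ.image z with hZ
  set m : ℝ := (Fintype.card ι : ℝ) with hm
  set N : ℝ := (Fintype.card V : ℝ) with hN
  clear_value X Y Z m N
  have hmpos : 0 < Fintype.card ι := Fintype.card_pos
  have hm0 : 0 < m := by rw [hm]; exact_mod_cast hmpos
  have hN0 : 0 < N := by rw [hN]; exact_mod_cast Fintype.card_pos
  have hXc : X.card = Fintype.card ι := by rw [hX, card_image_of_injective _ hx, card_univ]
  have hYc : Y.card = Fintype.card ι := by rw [hY, card_image_of_injective _ hy, card_univ]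
  have hZc : Z.card = Fintype.card ι := by rw [hZ, card_image_of_injective _ hz, card_univ]
  have hzi : ∀ i, z i = -(x i + y i) := fun i => eq_neg_of_add_eq_zero_right (hsum i)
  -- the diagonal triangles
  have hdiag : ∀ {A B C : Finset V} (i : ι), x i ∈ A → y i ∈ B → z i ∈ C →
      ((x i, y i) : V × V) ∈ Tri[A, B, C] := fun i ha hb hc =>
    mem_tri.2 ⟨ha, hb, by rw [← hzi]; exact hc⟩
  set T₀ : ℝ := (((Tri[X, Y, Z]).card : ℕ) : ℝ) with hT₀
  clear_value T₀
  have hT₀pos : 0 < T₀ := by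
    rw [hT₀, hX, hY, hZ]
    obtain ⟨i₀⟩ := (inferInstance : Nonempty ι)
    exact_mod_cast card_pos.2 ⟨_, hdiag i₀ (mem_image_of_mem _ (mem_univ _))
      (mem_image_of_mem _ (mem_univ _)) (mem_image_of_mem _ (mem_univ _))⟩
  -- `L₀ = log (N² / T₀) ≥ b / c ≥ 4`
  set L₀ := Real.log (N ^ 2 / T₀) with hL₀
  clear_value L₀
  have hexp0 : 0 < Real.exp (-(b / c)) := Real.exp_pos _
  have hδ₀le : T₀ / N ^ 2 ≤ Real.exp (-(b / c)) := by
    rw [div_le_iff₀ (by positivity)]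
    exact hsmall
  have hL₀b : b / c ≤ L₀ := by
    rw [hL₀, ← Real.log_exp (b / c)]
    refine Real.log_le_log (Real.exp_pos _) ?_
    rw [le_div_iff₀ hT₀pos]
    have h := hδ₀le
    rw [div_le_iff₀ (by positivity), Real.exp_neg] at h
    calc Real.exp (b / c) * T₀ ≤ Real.exp (b / c) * ((Real.exp (b / c))⁻¹ * N ^ 2) :=
        mul_le_mul_of_nonneg_left h (Real.exp_pos _).le
      _ = N ^ 2 := by field_simp
  have hL₀4 : 4 ≤ L₀ := hbc.trans hL₀b
  -- run the removal process
  have hT : Real.exp 1 * T₀ ≤ N ^ 2 := by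
    have h1 : Real.exp 1 ≤ Real.exp (b / c) := Real.exp_le_exp.2 (by linarith)
    have h2 : Real.exp (b / c) * T₀ ≤ N ^ 2 := by
      rw [← le_div_iff₀ hT₀pos, ← Real.exp_log (div_pos (by positivity) hT₀pos), ← hL₀]
      exact Real.exp_le_exp.2 hL₀b
    exact (mul_le_mul_of_nonneg_right h1 hT₀pos.le).trans h2
  obtain ⟨A, hA, B, hB, C, hC, hterm, hacc⟩ :=
    removal_process (V := V) hm0 _ X Y Z rfl (by rw [hT₀, hN] at hT; exact hT)
  set T₁ : ℝ := (((Tri[A, B, C]).card : ℕ) : ℝ) with hT₁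
  clear_value T₁
  rw [← hN, ← hT₀, ← hL₀] at hacc
  have hT₁le : T₁ ≤ T₀ := by
    rw [hT₁, hT₀]; exact_mod_cast card_le_card (tri_mono hA hB hC)
  -- at most `m / 2` vertices were removed
  have hPot₁ : 0 ≤ m / Real.log (N ^ 2 / T₁) := by
    rcases Nat.eq_zero_or_pos (Tri[A, B, C]).card with h0 | hpos
    · rw [hT₁, h0, Nat.cast_zero, div_zero, Real.log_zero, div_zero]
    · refine div_nonneg hm0.le (Real.log_nonneg ?_)
      have hT₁pos : 0 < T₁ := by rw [hT₁]; exact_mod_cast hpos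
      rw [le_div_iff₀ hT₁pos, one_mul]
      have h1e : (1 : ℝ) ≤ Real.exp 1 := by linarith only [Real.add_one_le_exp (1 : ℝ)]
      have : T₀ ≤ N ^ 2 :=
        calc T₀ = 1 * T₀ := (one_mul _).symm
          _ ≤ Real.exp 1 * T₀ := mul_le_mul_of_nonneg_right h1e hT₀pos.le
          _ ≤ N ^ 2 := hT
      linarith only [this, hT₁le]
  have hremoved : ((X.card + Y.card + Z.card : ℕ) : ℝ) - ((A.card + B.card + C.card : ℕ) : ℝ) ≤
      m / 2 := by
    refine hacc.trans ?_
    have h1 : m / L₀ ≤ m / 2 := div_le_div_of_nonneg_left hm0.le (by norm_num) (by linarith)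
    linarith
  -- hence some diagonal triangle survives, and `T₁ ≥ 1`
  have hsurv : ∃ i, x i ∈ A ∧ y i ∈ B ∧ z i ∈ C := by
    by_contra hnone
    push Not at hnone
    have hcover : (univ : Finset ι) ⊆ (univ.filter fun i => x i ∉ A) ∪
        (univ.filter fun i => y i ∉ B) ∪ (univ.filter fun i => z i ∉ C) := by
      intro i _
      by_cases ha : x i ∈ A
      · by_cases hb' : y i ∈ B
        · exact mem_union_right _ (mem_filter.2 ⟨mem_univ _, hnone i ha hb'⟩)
        · exact mem_union_left _ (mem_union_right _ (mem_filter.2 ⟨mem_univ _, hb'⟩))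
      · exact mem_union_left _ (mem_union_left _ (mem_filter.2 ⟨mem_univ _, ha⟩))
    have hcA := card_filter_mem_of_subset_image hx (hX ▸ hA)
    have hcB := card_filter_mem_of_subset_image hy (hY ▸ hB)
    have hcC := card_filter_mem_of_subset_image hz (hZ ▸ hC)
    have hnA := card_filter_add_card_filter_not (s := (univ : Finset ι)) (fun i => x i ∈ A)
    have hnB := card_filter_add_card_filter_not (s := (univ : Finset ι)) (fun i => y i ∈ B)
    have hnC := card_filter_add_card_filter_not (s := (univ : Finset ι)) (fun i => z i ∈ C)
    rw [card_univ] at hnA hnB hnC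
    have hle := (card_le_card hcover).trans ((card_union_le _ _).trans
      (Nat.add_le_add_right (card_union_le _ _) _))
    rw [card_univ] at hle
    have hleR : (Fintype.card ι : ℝ) ≤
        ((X.card + Y.card + Z.card : ℕ) : ℝ) - ((A.card + B.card + C.card : ℕ) : ℝ) := by
      rw [hXc, hYc, hZc]
      have : ((Fintype.card ι : ℕ) : ℝ) ≤ (((univ.filter fun i => x i ∉ A).card +
          (univ.filter fun i => y i ∉ B).card + (univ.filter fun i => z i ∉ C).card : ℕ) : ℝ) := by
        exact_mod_cast hle
      have eA : ((univ.filter fun i => x i ∉ A).card : ℝ) = Fintype.card ι - A.card := by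
        rw [← hcA, ← hnA]; push_cast; ring
      have eB : ((univ.filter fun i => y i ∉ B).card : ℝ) = Fintype.card ι - B.card := by
        rw [← hcB, ← hnB]; push_cast; ring
      have eC : ((univ.filter fun i => z i ∉ C).card : ℝ) = Fintype.card ι - C.card := by
        rw [← hcC, ← hnC]; push_cast; ring
      push_cast at this ⊢
      rw [eA, eB, eC] at this
      linarith
    linarith
  obtain ⟨i₁, hi₁A, hi₁B, hi₁C⟩ := hsurv
  have hT₁pos : 0 < T₁ := by
    rw [hT₁]; exact_mod_cast card_pos.2 ⟨_, hdiag i₁ hi₁A hi₁B hi₁C⟩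
  -- the terminal degree bound: all degrees `< θ(T₁) = ρ N`
  set L₁ := Real.log (N ^ 2 / T₁) with hL₁
  set ρ : ℝ := 2 * L₁ ^ 2 * T₁ / (m * N) with hρ
  clear_value L₁ ρ
  have hL₁ge : L₀ ≤ L₁ := by
    rw [hL₀, hL₁]
    exact Real.log_le_log (div_pos (by positivity) hT₀pos)
      (div_le_div_of_nonneg_left (by positivity) hT₁pos hT₁le)
  have hL₁0 : 0 < L₁ := by linarith
  have hρ0 : 0 < ρ := by rw [hρ]; positivity
  have hρN : ρ * N = 2 * L₁ ^ 2 * T₁ / m := by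
    rw [hρ]; field_simp
  have hdeg : ∀ t ∈ Tri[A, B, C],
      ((((Tri[A, B, C]).filter fun t' : V × V => t'.1 = t.1).card : ℕ) : ℝ) ≤ ρ * Fintype.card V ∧
      ((((Tri[A, B, C]).filter fun t' : V × V => t'.2 = t.2).card : ℕ) : ℝ) ≤ ρ * Fintype.card V ∧
      ((((Tri[A, B, C]).filter fun t' : V × V => t'.1 + t'.2 = t.1 + t.2).card : ℕ) : ℝ) ≤
        ρ * Fintype.card V := by
    intro t ht
    obtain ⟨h1, h2, h3⟩ := hterm t ht
    rw [← hN] at h1 h2 h3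
    rw [← hL₁] at h1 h2 h3
    rw [← hN, hρN]
    exact ⟨h1.le, h2.le, h3.le⟩
  -- the quantity `Q = δ₁^c L₁^b` and its monotonicity
  set δ₁ := T₁ / N ^ 2 with hδ₁
  set δ₀ := T₀ / N ^ 2 with hδ₀
  clear_value δ₁ δ₀
  have hδ₁0 : 0 < δ₁ := by rw [hδ₁]; positivity
  have hδ₁le : δ₁ ≤ δ₀ := by rw [hδ₁, hδ₀]; gcongr
  have hδ₁1 : δ₁ ≤ 1 := by
    refine hδ₁le.trans (hδ₀le.trans ?_)
    rw [Real.exp_le_one_iff]; linarith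
  have hmono : δ₁ ^ c * L₁ ^ b ≤ δ₀ ^ c * L₀ ^ b := by
    have h := rpow_mul_log_rpow_le hc0 hb0 hδ₁0 hδ₁le hδ₀le
    rw [hδ₁, hδ₀, one_div_div, one_div_div] at h
    rw [hδ₁, hδ₀, hL₁, hL₀]
    exact h
  have hQ0 : 0 ≤ δ₁ ^ c * L₁ ^ b := mul_nonneg (Real.rpow_nonneg hδ₁0.le _) (Real.rpow_nonneg hL₁0.le _)
  set ε := m / N with hε
  clear_value ε
  have hε0 : 0 < ε := by rw [hε]; positivity
  have hL₁b : (L₁ ^ 2) ^ (1 + c) = L₁ ^ b := by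
    rw [hb, ← Real.rpow_two, ← Real.rpow_mul hL₁0.le]
  -- main dichotomy on `ρ`
  have hmain : ε ^ (1 + c) ≤ 100 * (p : ℝ) ^ 6 * (δ₁ ^ c * L₁ ^ b) := by
    by_cases hρle : ρ ≤ 1 / (5 * (p : ℝ) ^ 3)
    · -- Lemma 5 applies
      have h5 := lemma5 (p := p) (fun t ht => hG1 t (tri_mono hA hB hC ht))
        (fun t ht t' ht' => hG2 t (tri_mono hA hB hC ht) t' (tri_mono hA hB hC ht')) hρ0 hρle hdeg
      rw [← hT₁, ← hN, ← hc] at h5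
      -- `δ₁ ≤ 211 p² ρ^{1+c}`
      have h6 : δ₁ ≤ 211 * (p : ℝ) ^ 2 * ρ ^ (1 + c) := by
        rw [hδ₁, div_le_iff₀ (by positivity)]; exact h5
      -- `ε ρ = 2 L₁² δ₁`
      have hερ : ε * ρ = 2 * L₁ ^ 2 * δ₁ := by
        rw [hε, hρ, hδ₁]; field_simp
      have h7 : ε ^ (1 + c) * δ₁ ≤ 211 * (p : ℝ) ^ 2 * ((2 * L₁ ^ 2) ^ (1 + c) * δ₁ ^ c) * δ₁ := by
        calc ε ^ (1 + c) * δ₁ ≤ ε ^ (1 + c) * (211 * (p : ℝ) ^ 2 * ρ ^ (1 + c)) :=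
            mul_le_mul_of_nonneg_left h6 (Real.rpow_nonneg hε0.le _)
          _ = 211 * (p : ℝ) ^ 2 * (ε * ρ) ^ (1 + c) := by
              rw [Real.mul_rpow hε0.le hρ0.le]; ring
          _ = 211 * (p : ℝ) ^ 2 * ((2 * L₁ ^ 2) ^ (1 + c) * δ₁ ^ c) * δ₁ := by
              rw [hερ, Real.mul_rpow (by positivity) hδ₁0.le, Real.rpow_add hδ₁0, Real.rpow_one]
              ring
      have h8 : ε ^ (1 + c) ≤ 211 * (p : ℝ) ^ 2 * ((2 * L₁ ^ 2) ^ (1 + c) * δ₁ ^ c) :=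
        le_of_mul_le_mul_right h7 hδ₁0
      have h9 : (2 * L₁ ^ 2) ^ (1 + c) ≤ 4 * L₁ ^ b := by
        rw [Real.mul_rpow (by norm_num) (by positivity), hL₁b]
        refine mul_le_mul_of_nonneg_right ?_ (Real.rpow_nonneg hL₁0.le _)
        calc (2 : ℝ) ^ (1 + c) ≤ 2 ^ ((2 : ℕ) : ℝ) :=
            Real.rpow_le_rpow_of_exponent_le (by norm_num) (by push_cast; linarith only [hc1])
          _ = 4 := by rw [Real.rpow_natCast]; norm_num
      have hp4 : (844 : ℝ) * (p : ℝ) ^ 2 ≤ 100 * (p : ℝ) ^ 6 := by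
        have hp2R : (2 : ℝ) ≤ p := by exact_mod_cast hp2
        have h4 : (4 : ℝ) ≤ (p : ℝ) ^ 2 := by
          have := pow_le_pow_left₀ (by norm_num) hp2R 2; norm_num at this; exact this
        have h16 : (16 : ℝ) ≤ ((p : ℝ) ^ 2) ^ 2 := by
          have := pow_le_pow_left₀ (by norm_num) h4 2; norm_num at this; exact this
        calc (844 : ℝ) * (p : ℝ) ^ 2 ≤ 1600 * (p : ℝ) ^ 2 :=
            mul_le_mul_of_nonneg_right (by norm_num) (sq_nonneg _)
          _ = 100 * (p : ℝ) ^ 2 * 16 := by ring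
          _ ≤ 100 * (p : ℝ) ^ 2 * ((p : ℝ) ^ 2) ^ 2 :=
            mul_le_mul_of_nonneg_left h16 (by positivity)
          _ = 100 * (p : ℝ) ^ 6 := by ring
      calc ε ^ (1 + c) ≤ 211 * (p : ℝ) ^ 2 * ((2 * L₁ ^ 2) ^ (1 + c) * δ₁ ^ c) := h8
        _ ≤ 211 * (p : ℝ) ^ 2 * ((4 * L₁ ^ b) * δ₁ ^ c) := by
            gcongr
        _ = 844 * (p : ℝ) ^ 2 * (δ₁ ^ c * L₁ ^ b) := by ring
        _ ≤ 100 * (p : ℝ) ^ 6 * (δ₁ ^ c * L₁ ^ b) := mul_le_mul_of_nonneg_right hp4 hQ0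
    · -- `ρ > 1/(5p³)`: then `ε < 10 p³ L₁² δ₁`
      push Not at hρle
      have h10 : ε ≤ 10 * (p : ℝ) ^ 3 * L₁ ^ 2 * δ₁ := by
        have h1 : 1 / (5 * (p : ℝ) ^ 3) * ε ≤ ρ * ε :=
          mul_le_mul_of_nonneg_right hρle.le hε0.le
        have h2 : ρ * ε = 2 * L₁ ^ 2 * δ₁ := by rw [hρ, hε, hδ₁]; field_simp
        rw [h2] at h1
        have h3 : ε = 5 * (p : ℝ) ^ 3 * (1 / (5 * (p : ℝ) ^ 3) * ε) := by field_simp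
        calc ε = 5 * (p : ℝ) ^ 3 * (1 / (5 * (p : ℝ) ^ 3) * ε) := h3
          _ ≤ 5 * (p : ℝ) ^ 3 * (2 * L₁ ^ 2 * δ₁) := mul_le_mul_of_nonneg_left h1 (by positivity)
          _ = 10 * (p : ℝ) ^ 3 * L₁ ^ 2 * δ₁ := by ring
      calc ε ^ (1 + c) ≤ (10 * (p : ℝ) ^ 3 * L₁ ^ 2 * δ₁) ^ (1 + c) :=
          Real.rpow_le_rpow hε0.le h10 (by linarith)
        _ = (10 * (p : ℝ) ^ 3) ^ (1 + c) * (δ₁ ^ c * L₁ ^ b) * δ₁ := by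
            rw [Real.mul_rpow (by positivity) hδ₁0.le, Real.mul_rpow (by positivity) (by positivity),
              hL₁b, Real.rpow_add hδ₁0, Real.rpow_one]
            ring
        _ ≤ (10 * (p : ℝ) ^ 3) ^ ((2 : ℕ) : ℝ) * (δ₁ ^ c * L₁ ^ b) * 1 := by
            have h1p : (1 : ℝ) ≤ 10 * (p : ℝ) ^ 3 := by
              have := one_le_pow₀ (M₀ := ℝ) hp1R.le (n := 3)
              linarith only [this]
            have hexp : (10 * (p : ℝ) ^ 3) ^ (1 + c) ≤ (10 * (p : ℝ) ^ 3) ^ ((2 : ℕ) : ℝ) :=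
              Real.rpow_le_rpow_of_exponent_le h1p (by push_cast; linarith only [hc1])
            exact mul_le_mul (mul_le_mul_of_nonneg_right hexp hQ0) hδ₁1 hδ₁0.le
              (mul_nonneg (Real.rpow_nonneg (by positivity) _) hQ0)
        _ = 100 * (p : ℝ) ^ 6 * (δ₁ ^ c * L₁ ^ b) := by
            rw [Real.rpow_natCast]; ring
  -- conclusion
  calc ε ^ (1 + c) ≤ 100 * (p : ℝ) ^ 6 * (δ₁ ^ c * L₁ ^ b) := hmain
    _ ≤ 100 * (p : ℝ) ^ 6 * (δ₀ ^ c * L₀ ^ b) := mul_le_mul_of_nonneg_left hmono (by positivity)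
    _ = 100 * (p : ℝ) ^ 6 * δ₀ ^ c * L₀ ^ b := by ring

/-! ### The `𝔽_p^{n+2}` embedding and Theorem 4 -/

/-- The embedded families `xᵢ' = (xᵢ, 1, 0)`, `yᵢ' = (yᵢ, −1, 1)`, `zᵢ' = (zᵢ, 0, −1)` in
`V × 𝔽_p × 𝔽_p` (proof of Thm. 4). -/
local notation3 (prettyPrint := false) "emb₁[" x "]" =>
  fun i => (x i, ((1 : ZMod p), (0 : ZMod p)))
local notation3 (prettyPrint := false) "emb₂[" y "]" =>
  fun i => (y i, ((-1 : ZMod p), (1 : ZMod p)))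
local notation3 (prettyPrint := false) "emb₃[" z "]" =>
  fun i => (z i, ((0 : ZMod p), (-1 : ZMod p)))

omit [Module (ZMod p) V] [Fintype V] in
/-- **The embedding preserves the triangle count** ("the triangles in `X' × Y' × Z'` correspond
exactly to the triangles in `X × Y × Z`"). [cite: FoxLovasz2017, Thm. 4 (proof)] -/
theorem card_tri_embed {ι : Type} [Fintype ι] (x y z : ι → V) :
    (Tri[univ.image (emb₁[x]), univ.image (emb₂[y]), univ.image (emb₃[z])]).card =
      (Tri[univ.image x, univ.image y, univ.image z]).card := by
  refine Finset.card_bij' (fun t _ => (t.1.1, t.2.1))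
    (fun t _ => ((t.1, ((1 : ZMod p), (0 : ZMod p))), (t.2, ((-1 : ZMod p), (1 : ZMod p)))))
    ?_ ?_ ?_ ?_
  · intro t ht
    obtain ⟨h1, h2, h3⟩ := mem_tri.1 ht
    obtain ⟨i, -, hi⟩ := mem_image.1 h1
    obtain ⟨j, -, hj⟩ := mem_image.1 h2
    obtain ⟨k, -, hk⟩ := mem_image.1 h3
    refine mem_tri.2 ⟨mem_image.2 ⟨i, mem_univ _, by rw [← hi]⟩,
      mem_image.2 ⟨j, mem_univ _, by rw [← hj]⟩, mem_image.2 ⟨k, mem_univ _, ?_⟩⟩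
    have h := congrArg Prod.fst hk
    simpa using h
  · intro t ht
    obtain ⟨h1, h2, h3⟩ := mem_tri.1 ht
    obtain ⟨i, -, hi⟩ := mem_image.1 h1
    obtain ⟨j, -, hj⟩ := mem_image.1 h2
    obtain ⟨k, -, hk⟩ := mem_image.1 h3
    refine mem_tri.2 ⟨mem_image.2 ⟨i, mem_univ _, by simp [hi]⟩,
      mem_image.2 ⟨j, mem_univ _, by simp [hj]⟩, mem_image.2 ⟨k, mem_univ _, ?_⟩⟩
    refine Prod.ext ?_ (Prod.ext ?_ ?_)
    · simpa using hk
    · simp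
    · simp
  · intro t ht
    obtain ⟨h1, h2, -⟩ := mem_tri.1 ht
    obtain ⟨i, -, hi⟩ := mem_image.1 h1
    obtain ⟨j, -, hj⟩ := mem_image.1 h2
    refine Prod.ext (Prod.ext rfl ?_) (Prod.ext rfl ?_)
    · simp [← hi]
    · simp [← hj]
  · intro t _
    rfl

omit [Fintype V] in
/-- **Genericity (G1) of the embedded configuration**: `(x, 1, 0)` and `(y, −1, 1)` are linearly
independent ("any two vectors from `X ∪ Y ∪ Z` are linearly independent").
[cite: FoxLovasz2017, Thm. 4 (proof)] -/
theorem embed_G1 {ι : Type} [Fintype ι] (x y z : ι → V) :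
    ∀ t ∈ Tri[univ.image (emb₁[x]), univ.image (emb₂[y]), univ.image (emb₃[z])],
      LinearIndependent (ZMod p) ![t.1, t.2] := by
  intro t ht
  obtain ⟨h1, h2, -⟩ := mem_tri.1 ht
  obtain ⟨i, -, hi⟩ := mem_image.1 h1
  obtain ⟨j, -, hj⟩ := mem_image.1 h2
  rw [LinearIndependent.pair_iff]
  intro a b hab
  rw [← hi, ← hj] at hab
  have h21 := congrArg (fun v => v.2.1) hab
  have h22 := congrArg (fun v => v.2.2) hab
  simp only [Prod.snd_add, Prod.smul_snd, Prod.fst_add, Prod.smul_fst, smul_eq_mul, mul_one,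
    mul_zero, mul_neg, Prod.snd_zero, Prod.fst_zero, zero_add] at h21 h22
  constructor
  · rw [h22] at h21; simpa using h21
  · exact h22

omit [Fintype V] in
/-- **Genericity (G2') of the embedded configuration**: a triangle whose two free vertices lie in
the span of another triangle coincides with it ("any two-dimensional subspace contains at most one
triangle"). [cite: FoxLovasz2017, Thm. 4 (proof)] -/
theorem embed_G2 {ι : Type} [Fintype ι] (x y z : ι → V) :
    ∀ t ∈ Tri[univ.image (emb₁[x]), univ.image (emb₂[y]), univ.image (emb₃[z])],
      ∀ t' ∈ Tri[univ.image (emb₁[x]), univ.image (emb₂[y]), univ.image (emb₃[z])],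
      t'.1 ∈ Submodule.span (ZMod p) {t.1, t.2} → t'.2 ∈ Submodule.span (ZMod p) {t.1, t.2} →
      t' = t := by
  intro t ht t' ht' hs1 hs2
  obtain ⟨h1, h2, -⟩ := mem_tri.1 ht
  obtain ⟨i, -, hi⟩ := mem_image.1 h1
  obtain ⟨j, -, hj⟩ := mem_image.1 h2
  obtain ⟨h1', h2', -⟩ := mem_tri.1 ht'
  obtain ⟨i', -, hi'⟩ := mem_image.1 h1'
  obtain ⟨j', -, hj'⟩ := mem_image.1 h2'
  obtain ⟨a, b, hab⟩ := Submodule.mem_span_pair.1 hs1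
  obtain ⟨a', b', hab'⟩ := Submodule.mem_span_pair.1 hs2
  -- second coordinates force `a = 1, b = 0` and `a' = 0, b' = 1`
  have e1 := congrArg (fun v => v.2.1) hab
  have e2 := congrArg (fun v => v.2.2) hab
  have e1' := congrArg (fun v => v.2.1) hab'
  have e2' := congrArg (fun v => v.2.2) hab'
  rw [← hi, ← hj, ← hi'] at e1 e2
  rw [← hi, ← hj, ← hj'] at e1' e2'
  simp only [Prod.snd_add, Prod.smul_snd, Prod.fst_add, Prod.smul_fst, smul_eq_mul, mul_one,
    mul_zero, mul_neg, zero_add] at e1 e2 e1' e2'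
  -- e2 : b = 0, e1 : a - b = 1 ; e2' : b' = 1, e1' : a' - b' = -1
  have hb : b = 0 := e2
  have ha : a = 1 := by rw [hb] at e1; simpa using e1
  have hb' : b' = 1 := e2'
  have ha' : a' = 0 := by
    rw [hb'] at e1'
    have : a' + -1 = -1 := e1'
    simpa using this
  rw [ha, hb, one_smul, zero_smul, add_zero] at hab
  rw [ha', hb', zero_smul, one_smul, zero_add] at hab'
  exact Prod.ext hab.symm hab'.symm

/-- **Theorem 4** (Fox–Lovász 2017), quantitative form: for `m ≥ 1` pairwise disjoint triangles
`(xᵢ, yᵢ, zᵢ)` in `V` spanning `T` triangles, with `N' = p²N` (the size of `V × 𝔽_p²`), either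
`T > e^{−2(1+c_p)/c_p} N'²` or `(m/N')^{1+c_p} ≤ 100 p⁶ (T/N'²)^{c_p} log(N'²/T)^{2(1+c_p)}`
(paper: `δ ≥ ε^{C_p + o(1)}`). Proof: embed into `V × 𝔽_p²` and apply Lemma 6.
[cite: FoxLovasz2017, Thm. 4] -/
theorem theorem4 {ι : Type} [Fintype ι] [Nonempty ι] {x y z : ι → V} (hx : Function.Injective x)
    (hy : Function.Injective y) (hz : Function.Injective z) (hsum : ∀ i, x i + y i + z i = 0) :
    Real.exp (-(2 * (1 + foxLovaszExponent p) / foxLovaszExponent p)) *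
        ((p : ℝ) ^ 2 * Fintype.card V) ^ 2 <
      (((Tri[univ.image x, univ.image y, univ.image z]).card : ℕ) : ℝ) ∨
    ((Fintype.card ι : ℝ) / ((p : ℝ) ^ 2 * Fintype.card V)) ^ (1 + foxLovaszExponent p) ≤
      100 * (p : ℝ) ^ 6 *
        ((((Tri[univ.image x, univ.image y, univ.image z]).card : ℕ) : ℝ) /
            ((p : ℝ) ^ 2 * Fintype.card V) ^ 2) ^ foxLovaszExponent p *
        Real.log (((p : ℝ) ^ 2 * Fintype.card V) ^ 2 /
            ((Tri[univ.image x, univ.image y, univ.image z]).card : ℕ)) ^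
          (2 * (1 + foxLovaszExponent p)) := by
  classical
  rcases lt_or_ge (Real.exp (-(2 * (1 + foxLovaszExponent p) / foxLovaszExponent p)) *
      ((p : ℝ) ^ 2 * Fintype.card V) ^ 2)
      (((Tri[univ.image x, univ.image y, univ.image z]).card : ℕ) : ℝ) with hlt | hge
  · exact Or.inl hlt
  right
  -- pass to `V' = V × 𝔽_p × 𝔽_p`
  have hcard : (Fintype.card (V × (ZMod p × ZMod p)) : ℝ) = (p : ℝ) ^ 2 * Fintype.card V := by
    rw [Fintype.card_prod, Fintype.card_prod, ZMod.card]
    push_cast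
    ring
  have hx' : Function.Injective (emb₁[x]) := fun i j h => hx (congrArg Prod.fst h)
  have hy' : Function.Injective (emb₂[y]) := fun i j h => hy (congrArg Prod.fst h)
  have hz' : Function.Injective (emb₃[z]) := fun i j h => hz (congrArg Prod.fst h)
  have hsum' : ∀ i, (emb₁[x]) i + (emb₂[y]) i + (emb₃[z]) i = 0 := by
    intro i
    refine Prod.ext ?_ (Prod.ext ?_ ?_)
    · simpa using hsum i
    · simp
    · simp
  have hT := card_tri_embed (p := p) x y z
  have h6 := lemma6 (V := V × (ZMod p × ZMod p)) hx' hy' hz' hsum' (embed_G1 x y z)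
    (embed_G2 x y z) (by rw [hT, hcard]; exact hge)
  rw [hT, hcard] at h6
  exact h6

/-! ### Theorem 3: the tensor-power trick -/

omit [Module (ZMod p) V] [Fintype V] in
/-- **Triangle counts are multiplicative under powers** ("the number of triangles in
`X^k × Y^k × Z^k` is `δ^k N^{2k}`"). [cite: FoxLovasz2017, Thm. 3 (proof)] -/
theorem card_tri_pow {ι : Type} [Fintype ι] [DecidableEq ι] (x y z : ι → V) (k : ℕ) :
    (Tri[univ.image (fun (f : Fin k → ι) (j : Fin k) => x (f j)),
         univ.image (fun (f : Fin k → ι) (j : Fin k) => y (f j)),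
         univ.image (fun (f : Fin k → ι) (j : Fin k) => z (f j))]).card =
      (Tri[univ.image x, univ.image y, univ.image z]).card ^ k := by
  have himg : ∀ w : ι → V, univ.image (fun (f : Fin k → ι) (j : Fin k) => w (f j)) =
      Fintype.piFinset fun _ : Fin k => univ.image w := by
    intro w
    rw [Fintype.piFinset_image, Fintype.piFinset_univ]
  rw [himg x, himg y, himg z, ← Fintype.card_piFinset_const]
  refine Finset.card_bij' (fun t _ => fun j => (t.1 j, t.2 j))
    (fun g _ => (fun j => (g j).1, fun j => (g j).2)) ?_ ?_ ?_ ?_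
  · intro t ht
    rw [Fintype.mem_piFinset]
    intro j
    obtain ⟨h1, h2, h3⟩ := mem_tri.1 ht
    rw [Fintype.mem_piFinset] at h1 h2 h3
    exact mem_tri.2 ⟨h1 j, h2 j, by simpa using h3 j⟩
  · intro g hg
    rw [Fintype.mem_piFinset] at hg
    refine mem_tri.2 ⟨?_, ?_, ?_⟩
    · exact Fintype.mem_piFinset.2 fun j => (mem_tri.1 (hg j)).1
    · exact Fintype.mem_piFinset.2 fun j => (mem_tri.1 (hg j)).2.1
    · refine Fintype.mem_piFinset.2 fun j => ?_
      have h := (mem_tri.1 (hg j)).2.2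
      simpa using h
  · intro t _
    rfl
  · intro g _
    rfl

/-- `θ^k (α + βk)^b → 0`-type domination: for `0 < θ < 1` and `η > 0` there is `k ≥ 1` with
`θ^k (α + βk)^b < η` and `θ₂^k < η₂` (`0 ≤ θ₂ < 1`). The analytic input of the tensor-power
trick ("letting `k → ∞`, we obtain a contradiction"). [cite: FoxLovasz2017, Thm. 3 (proof)] -/
theorem exists_pow_mul_rpow_lt {θ θ₂ α β b η η₂ : ℝ} (hθ0 : 0 < θ) (hθ1 : θ < 1) (hθ₂0 : 0 ≤ θ₂)
    (hθ₂1 : θ₂ < 1) (hα : 0 ≤ α) (hβ : 0 ≤ β) (hb : 0 ≤ b) (hη : 0 < η) (hη₂ : 0 < η₂) :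
    ∃ k : ℕ, 1 ≤ k ∧ θ ^ k * (α + β * k) ^ b < η ∧ θ₂ ^ k < η₂ := by
  set n₀ := ⌈b⌉₊ with hn₀
  have hM : 0 < (α + β + 1) ^ b := Real.rpow_pos_of_pos (by linarith) _
  -- `k^{n₀} θ^k → 0`
  have h1 : Filter.Tendsto (fun k : ℕ => (k : ℝ) ^ n₀ * θ ^ k) Filter.atTop (nhds 0) :=
    tendsto_pow_const_mul_const_pow_of_abs_lt_one n₀ (abs_lt.2 ⟨by linarith, hθ1⟩)
  have h2 : Filter.Tendsto (fun k : ℕ => θ₂ ^ k) Filter.atTop (nhds 0) :=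
    tendsto_pow_atTop_nhds_zero_of_lt_one hθ₂0 hθ₂1
  have e1 := h1.eventually_lt_const (div_pos hη hM)
  have e2 := h2.eventually_lt_const hη₂
  obtain ⟨k, hk1, hk2, hk3⟩ := ((Filter.eventually_ge_atTop 1).and (e1.and e2)).exists
  refine ⟨k, hk1, ?_, hk3⟩
  have hk : (1 : ℝ) ≤ k := by exact_mod_cast hk1
  -- `(α + βk)^b ≤ (α+β+1)^b k^{n₀}`
  have h3 : (α + β * k) ^ b ≤ (α + β + 1) ^ b * (k : ℝ) ^ n₀ := by
    have h4 : α + β * k ≤ (α + β + 1) * k := by nlinarith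
    calc (α + β * k) ^ b ≤ ((α + β + 1) * k) ^ b :=
          Real.rpow_le_rpow (by positivity) h4 hb
      _ = (α + β + 1) ^ b * (k : ℝ) ^ b := Real.mul_rpow (by linarith) (by positivity)
      _ ≤ (α + β + 1) ^ b * (k : ℝ) ^ (n₀ : ℝ) :=
          mul_le_mul_of_nonneg_left (Real.rpow_le_rpow_of_exponent_le hk (Nat.le_ceil b)) hM.le
      _ = (α + β + 1) ^ b * (k : ℝ) ^ n₀ := by rw [Real.rpow_natCast]
  calc θ ^ k * (α + β * k) ^ b ≤ θ ^ k * ((α + β + 1) ^ b * (k : ℝ) ^ n₀) :=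
        mul_le_mul_of_nonneg_left h3 (pow_nonneg hθ0.le k)
    _ = (α + β + 1) ^ b * ((k : ℝ) ^ n₀ * θ ^ k) := by ring
    _ < (α + β + 1) ^ b * (η / (α + β + 1) ^ b) := mul_lt_mul_of_pos_left hk2 hM
    _ = η := by field_simp

/-- **Theorem 3** (Fox–Lovász 2017): `m = εN` pairwise disjoint triangles `(xᵢ, yᵢ, zᵢ)` in a
finite `𝔽_p`-vector space `V` span at least `ε^{C_p} N²` triangles in `X × Y × Z`,
`X = {xᵢ}, Y = {yᵢ}, Z = {zᵢ}`, `C_p = 1 + 1/c_p`. Proof: Theorem 4 applied to the `k`-th tensor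
powers, `k → ∞`. [cite: FoxLovasz2017, Thm. 3] -/
theorem theorem3 {ι : Type} [Fintype ι] [Nonempty ι] [DecidableEq ι] {x y z : ι → V}
    (hx : Function.Injective x) (hy : Function.Injective y) (hz : Function.Injective z)
    (hsum : ∀ i, x i + y i + z i = 0) :
    ((Fintype.card ι : ℝ) / Fintype.card V) ^ foxLovaszRemovalExponent p *
        (Fintype.card V : ℝ) ^ 2 ≤
      (((Tri[univ.image x, univ.image y, univ.image z]).card : ℕ) : ℝ) := by
  classical
  have hp2 : 2 ≤ p := hp.out.two_le
  have hp0 : (0 : ℝ) < p := by exact_mod_cast hp.out.pos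
  have hp1R : (1 : ℝ) < p := by exact_mod_cast hp.out.one_lt
  set c := foxLovaszExponent p with hc
  have hc0 : 0 < c := hc ▸ foxLovaszExponent_pos hp2
  have hC : foxLovaszRemovalExponent p = 1 + 1 / c := by rw [foxLovaszRemovalExponent, hc]
  set b : ℝ := 2 * (1 + c) with hb
  set a : ℝ := Real.exp (-(2 * (1 + c) / c)) with ha
  clear_value c
  have hb0 : 0 < b := by rw [hb]; linarith
  have ha0 : 0 < a := Real.exp_pos _
  set m : ℝ := (Fintype.card ι : ℝ) with hm
  set N : ℝ := (Fintype.card V : ℝ) with hN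
  set T : ℝ := (((Tri[univ.image x, univ.image y, univ.image z]).card : ℕ) : ℝ) with hT
  clear_value m N T
  have hm0 : 0 < m := by rw [hm]; exact_mod_cast Fintype.card_pos
  have hN0 : 0 < N := by rw [hN]; exact_mod_cast Fintype.card_pos
  have hmN : m ≤ N := by rw [hm, hN]; exact_mod_cast Fintype.card_le_of_injective x hx
  have hzi : ∀ i, z i = -(x i + y i) := fun i => eq_neg_of_add_eq_zero_right (hsum i)
  have hT1 : 1 ≤ T := by
    rw [hT]
    obtain ⟨i₀⟩ := (inferInstance : Nonempty ι)
    exact_mod_cast card_pos.2 ⟨((x i₀, y i₀) : V × V), mem_tri.2 ⟨mem_image_of_mem x (mem_univ _),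
      mem_image_of_mem y (mem_univ _), by rw [← hzi]; exact mem_image_of_mem z (mem_univ _)⟩⟩
  have hT0 : 0 < T := by linarith
  rw [hC]
  set ε := m / N with hε
  set δ := T / N ^ 2 with hδ
  have hε0 : 0 < ε := div_pos hm0 hN0
  have hε1 : ε ≤ 1 := (div_le_one hN0).2 hmN
  have hδ0 : 0 < δ := by rw [hδ]; positivity
  by_contra hlt
  rw [not_le] at hlt
  -- `δ < ε^{C_p}`, hence `θ = δ^c / ε^{1+c} < 1` and `δ < 1`
  have hδε : δ < ε ^ (1 + 1 / c) := by
    rw [hδ, div_lt_iff₀ (by positivity)]; exact hlt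
  have hδ1 : δ < 1 := lt_of_lt_of_le hδε (Real.rpow_le_one hε0.le hε1 (by positivity))
  have hεc : 0 < ε ^ (1 + c) := Real.rpow_pos_of_pos hε0 _
  set θ := δ ^ c / ε ^ (1 + c) with hθ
  have hθ0 : 0 < θ := by rw [hθ]; exact div_pos (Real.rpow_pos_of_pos hδ0 _) hεc
  have hθ1 : θ < 1 := by
    rw [hθ, div_lt_one hεc]
    calc δ ^ c < (ε ^ (1 + 1 / c)) ^ c := Real.rpow_lt_rpow hδ0.le hδε hc0
      _ = ε ^ (1 + c) := by
          rw [← Real.rpow_mul hε0.le]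
          congr 1
          field_simp
          ring
  have hδc : δ ^ c = θ * ε ^ (1 + c) := by rw [hθ]; field_simp
  -- the target quantity `η` of the second disjunct
  set η : ℝ := (p : ℝ) ^ (4 * c) / (100 * (p : ℝ) ^ 6 * (p : ℝ) ^ (2 * (1 + c))) with hη
  have hη0 : 0 < η := by rw [hη]; positivity
  -- choose `k`
  obtain ⟨k, hk1, hkB, hkA⟩ := exists_pow_mul_rpow_lt (α := 4 * Real.log p) (β := Real.log (1 / δ))
    (b := b) hθ0 hθ1 hδ0.le hδ1 (by positivity)
    (Real.log_nonneg ((one_le_div hδ0).2 hδ1.le)) hb0.le hη0 (mul_pos ha0 (pow_pos hp0 4))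
  -- Theorem 4 for the `k`-th power
  have hxk : Function.Injective (fun (f : Fin k → ι) (j : Fin k) => x (f j)) :=
    fun f g h => funext fun j => hx (congrFun h j)
  have hyk : Function.Injective (fun (f : Fin k → ι) (j : Fin k) => y (f j)) :=
    fun f g h => funext fun j => hy (congrFun h j)
  have hzk : Function.Injective (fun (f : Fin k → ι) (j : Fin k) => z (f j)) :=
    fun f g h => funext fun j => hz (congrFun h j)
  have hsumk : ∀ f : Fin k → ι, (fun j => x (f j)) + (fun j => y (f j)) + (fun j => z (f j)) = 0 :=
    fun f => funext fun j => by simpa using hsum (f j)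
  have h4 := theorem4 (p := p) (V := Fin k → V) hxk hyk hzk hsumk
  rw [card_tri_pow x y z k, ← hc, Fintype.card_fun, Fintype.card_fin, Fintype.card_fun,
    Fintype.card_fin] at h4
  push_cast at h4
  rw [← hm, ← hN, ← hT] at h4
  -- useful identities
  have hTk : T ^ k = δ ^ k * (N ^ k) ^ 2 := by
    rw [hδ, div_pow, ← pow_mul, ← pow_mul, mul_comm 2 k]; field_simp
  have hNk0 : 0 < (p : ℝ) ^ 2 * N ^ k := by positivity
  rcases h4 with hA | hB
  · -- first disjunct: `a (p² N^k)² < T^k`, i.e. `a p⁴ < δ^k` — contradicts `hkA`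
    rw [hTk] at hA
    have : a * (p : ℝ) ^ 4 < δ ^ k := by
      have h1 : a * ((p : ℝ) ^ 2 * N ^ k) ^ 2 = (a * (p : ℝ) ^ 4) * (N ^ k) ^ 2 := by ring
      rw [h1] at hA
      exact lt_of_mul_lt_mul_right hA (by positivity)
    linarith
  · -- second disjunct, normalised: `η ≤ θ^k (4 log p + k log(1/δ))^b` — contradicts `hkB`
    have hεk : m ^ k / ((p : ℝ) ^ 2 * N ^ k) = ε ^ k / (p : ℝ) ^ 2 := by
      rw [hε, div_pow]; field_simp
    have hδk : T ^ k / ((p : ℝ) ^ 2 * N ^ k) ^ 2 = δ ^ k / (p : ℝ) ^ 4 := by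
      rw [hTk]; field_simp
    have hLk : Real.log (((p : ℝ) ^ 2 * N ^ k) ^ 2 / T ^ k) =
        4 * Real.log p + Real.log (1 / δ) * k := by
      rw [hTk]
      have h1 : ((p : ℝ) ^ 2 * N ^ k) ^ 2 / (δ ^ k * (N ^ k) ^ 2) = (p : ℝ) ^ 4 / δ ^ k := by
        field_simp
      rw [h1, Real.log_div (by positivity) (by positivity), Real.log_pow, Real.log_pow, one_div,
        Real.log_inv]
      push_cast; ring
    rw [hεk, hδk, hLk] at hB
    -- expand the powers
    have hlhs : (ε ^ k / (p : ℝ) ^ 2) ^ (1 + c) = (ε ^ (1 + c)) ^ k / (p : ℝ) ^ (2 * (1 + c)) := by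
      rw [Real.div_rpow (by positivity) (by positivity), ← Real.rpow_pow_comm hε0.le,
        ← Real.rpow_natCast ((p : ℝ)) 2, ← Real.rpow_mul hp0.le]
      push_cast; ring_nf
    have hrhs : (δ ^ k / (p : ℝ) ^ 4) ^ c = θ ^ k * (ε ^ (1 + c)) ^ k / (p : ℝ) ^ (4 * c) := by
      rw [Real.div_rpow (by positivity) (by positivity), ← Real.rpow_pow_comm hδ0.le, hδc, mul_pow,
        ← Real.rpow_natCast ((p : ℝ)) 4, ← Real.rpow_mul hp0.le]
      push_cast; ring_nf
    rw [hlhs, hrhs] at hB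
    have hEk : 0 < (ε ^ (1 + c)) ^ k := pow_pos hεc k
    -- divide by `(ε^{1+c})^k`
    have hB' : η ≤ θ ^ k * (4 * Real.log p + Real.log (1 / δ) * k) ^ b := by
      rw [hη, div_le_iff₀ (by positivity)]
      have h2 := hB
      rw [div_le_iff₀ (by positivity : (0 : ℝ) < (p : ℝ) ^ (2 * (1 + c)))] at h2
      -- h2 : (ε^{1+c})^k ≤ 100 p⁶ (θ^k E^k / p^{4c}) L^b · p^{2(1+c)}
      have h3 : (ε ^ (1 + c)) ^ k * (p : ℝ) ^ (4 * c) ≤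
          (ε ^ (1 + c)) ^ k * (θ ^ k * (4 * Real.log p + Real.log (1 / δ) * k) ^ b *
            (100 * (p : ℝ) ^ 6 * (p : ℝ) ^ (2 * (1 + c)))) := by
        have hp4c : 0 < (p : ℝ) ^ (4 * c) := by positivity
        calc (ε ^ (1 + c)) ^ k * (p : ℝ) ^ (4 * c)
            ≤ (100 * (p : ℝ) ^ 6 * (θ ^ k * (ε ^ (1 + c)) ^ k / (p : ℝ) ^ (4 * c)) *
                (4 * Real.log p + Real.log (1 / δ) * k) ^ b * (p : ℝ) ^ (2 * (1 + c))) *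
                (p : ℝ) ^ (4 * c) := mul_le_mul_of_nonneg_right h2 hp4c.le
          _ = (ε ^ (1 + c)) ^ k * (θ ^ k * (4 * Real.log p + Real.log (1 / δ) * k) ^ b *
                (100 * (p : ℝ) ^ 6 * (p : ℝ) ^ (2 * (1 + c)))) := by
              field_simp
      exact le_of_mul_le_mul_left h3 hEk
    linarith

/-! ### Theorem 1 from Theorem 3: a maximum family of disjoint triangles -/

/-- Families of triangles with pairwise distinct `x`-, `y`- and `z`-coordinates ("disjoint
triangles"). -/
local notation3 (prettyPrint := false) "IsMatching[" M "]" =>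
  (∀ t ∈ M, ∀ t' ∈ M, t.1 = t'.1 → t = t') ∧ (∀ t ∈ M, ∀ t' ∈ M, t.2 = t'.2 → t = t') ∧
    (∀ t ∈ M, ∀ t' ∈ M, t.1 + t.2 = t'.1 + t'.2 → t = t')

/-- **Theorem 1 from Theorem 3** ("Proof that Theorem 3 implies Theorem 1": take disjoint
triangles greedily; if fewer than `(ε/3)N` can be taken, their `< εN` vertices meet every
triangle; otherwise Theorem 3 yields `≥ (ε/3)^{C_p} N²` triangles): in any finite `𝔽_p`-vector
space, fewer than `(ε/3)^{C_p} N²` triangles in `X × Y × Z` can be destroyed by removing at most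
`εN` elements. [cite: FoxLovasz2017, Thm. 1 (proof from Thm. 3)] -/
theorem theorem1 {ε : ℝ} (hε0 : 0 < ε) (X Y Z : Finset V)
    (hT : (((Tri[X, Y, Z]).card : ℕ) : ℝ) <
      (ε / 3) ^ foxLovaszRemovalExponent p * (Fintype.card V : ℝ) ^ 2) :
    ∃ R : Finset V, (R.card : ℝ) ≤ ε * Fintype.card V ∧
      ∀ a ∈ X, a ∉ R → ∀ b ∈ Y, b ∉ R → ∀ c ∈ Z, c ∉ R → a + b + c ≠ 0 := by
  classical
  have hN0 : (0 : ℝ) < Fintype.card V := by exact_mod_cast Fintype.card_pos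
  -- a maximum matching
  set 𝓜 := (Tri[X, Y, Z]).powerset.filter (fun M => IsMatching[M]) with h𝓜
  have h𝓜ne : 𝓜.Nonempty := ⟨∅, by simp [h𝓜]⟩
  obtain ⟨M, hM𝓜, hMmax⟩ := exists_max_image 𝓜 Finset.card h𝓜ne
  have hM' := mem_filter.1 hM𝓜
  have hMsub : M ⊆ Tri[X, Y, Z] := mem_powerset.1 hM'.1
  obtain ⟨hM1, hM2, hM3⟩ := hM'.2
  by_cases hcase : 3 * (M.card : ℝ) ≤ ε * Fintype.card V
  · -- the vertices of `M` meet every triangle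
    refine ⟨M.image Prod.fst ∪ M.image Prod.snd ∪ M.image (fun t => -(t.1 + t.2)), ?_, ?_⟩
    · calc ((M.image Prod.fst ∪ M.image Prod.snd ∪ M.image (fun t => -(t.1 + t.2))).card : ℝ)
          ≤ ((M.card + M.card + M.card : ℕ) : ℝ) := by
            exact_mod_cast (card_union_le _ _).trans (add_le_add ((card_union_le _ _).trans
              (add_le_add card_image_le card_image_le)) card_image_le)
        _ = 3 * M.card := by push_cast; ring
        _ ≤ ε * Fintype.card V := hcase
    · intro a ha haR b hb hbR c hc hcR habc
      have hc' : c = -(a + b) := eq_neg_of_add_eq_zero_right habc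
      have ht₀ : ((a, b) : V × V) ∈ Tri[X, Y, Z] := mem_tri.2 ⟨ha, hb, hc' ▸ hc⟩
      simp only [mem_union, mem_image, not_or, not_exists, not_and] at haR hbR hcR
      have haM : ∀ t ∈ M, t.1 ≠ a := fun t ht h => haR.1.1 t ht h
      have hbM : ∀ t ∈ M, t.2 ≠ b := fun t ht h => hbR.1.2 t ht h
      have hcM : ∀ t ∈ M, -(t.1 + t.2) ≠ c := fun t ht h => hcR.2 t ht h
      have ht₀M : ((a, b) : V × V) ∉ M := fun h => haM _ h rfl
      have hins : insert ((a, b) : V × V) M ∈ 𝓜 := by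
        rw [h𝓜, mem_filter, mem_powerset]
        refine ⟨insert_subset ht₀ hMsub, ?_, ?_, ?_⟩
        · intro t ht t' ht' h
          rcases mem_insert.1 ht with rfl | ht <;> rcases mem_insert.1 ht' with rfl | ht'
          · rfl
          · exact absurd h.symm (haM t' ht')
          · exact absurd h (haM t ht)
          · exact hM1 t ht t' ht' h
        · intro t ht t' ht' h
          rcases mem_insert.1 ht with rfl | ht <;> rcases mem_insert.1 ht' with rfl | ht'
          · rfl
          · exact absurd h.symm (hbM t' ht')
          · exact absurd h (hbM t ht)
          · exact hM2 t ht t' ht' h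
        · intro t ht t' ht' h
          rcases mem_insert.1 ht with rfl | ht <;> rcases mem_insert.1 ht' with rfl | ht'
          · rfl
          · refine absurd ?_ (hcM t' ht')
            rw [← h, ← hc']
          · refine absurd ?_ (hcM t ht)
            rw [h, ← hc']
          · exact hM3 t ht t' ht' h
      have hle := hMmax _ hins
      rw [card_insert_of_notMem ht₀M] at hle
      omega
  · -- Theorem 3 applies to `M`
    rw [not_le] at hcase
    have hMpos : 0 < M.card := by
      rcases Nat.eq_zero_or_pos M.card with h0 | hpos
      · rw [h0, Nat.cast_zero, mul_zero] at hcase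
        exact absurd hcase (not_lt.2 (by positivity))
      · exact hpos
    obtain ⟨t₀, ht₀⟩ := card_pos.1 hMpos
    haveI : Nonempty M := ⟨⟨t₀, ht₀⟩⟩
    have hx : Function.Injective (fun t : M => t.1.1) :=
      fun t t' h => Subtype.ext (hM1 _ t.2 _ t'.2 h)
    have hy : Function.Injective (fun t : M => t.1.2) :=
      fun t t' h => Subtype.ext (hM2 _ t.2 _ t'.2 h)
    have hz : Function.Injective (fun t : M => -(t.1.1 + t.1.2)) :=
      fun t t' h => Subtype.ext (hM3 _ t.2 _ t'.2 (neg_inj.1 h))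
    have hsum : ∀ t : M, t.1.1 + t.1.2 + -(t.1.1 + t.1.2) = 0 := fun t => add_neg_cancel _
    have h3 := theorem3 (p := p) (V := V) hx hy hz hsum
    rw [Fintype.card_coe] at h3
    have hsub : Tri[univ.image (fun t : M => t.1.1), univ.image (fun t : M => t.1.2),
        univ.image (fun t : M => -(t.1.1 + t.1.2))] ⊆ Tri[X, Y, Z] := by
      refine tri_mono ?_ ?_ ?_
      · intro v hv
        obtain ⟨t, -, rfl⟩ := mem_image.1 hv
        exact (mem_tri.1 (hMsub t.2)).1
      · intro v hv
        obtain ⟨t, -, rfl⟩ := mem_image.1 hv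
        exact (mem_tri.1 (hMsub t.2)).2.1
      · intro v hv
        obtain ⟨t, -, rfl⟩ := mem_image.1 hv
        exact (mem_tri.1 (hMsub t.2)).2.2
    have h4 : (((Tri[univ.image (fun t : M => t.1.1), univ.image (fun t : M => t.1.2),
        univ.image (fun t : M => -(t.1.1 + t.1.2))]).card : ℕ) : ℝ) ≤
        (((Tri[X, Y, Z]).card : ℕ) : ℝ) := by
      exact_mod_cast card_le_card hsub
    have hC0 : 0 < foxLovaszRemovalExponent p := by
      linarith [one_lt_foxLovaszRemovalExponent hp.out.two_le]
    have h5 : (ε / 3) ^ foxLovaszRemovalExponent p <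
        ((M.card : ℝ) / Fintype.card V) ^ foxLovaszRemovalExponent p := by
      refine Real.rpow_lt_rpow (by positivity) ?_ hC0
      rw [lt_div_iff₀ hN0]
      linarith
    have h6 := mul_lt_mul_of_pos_right h5 (by positivity : (0 : ℝ) < (Fintype.card V : ℝ) ^ 2)
    linarith [h3, h4, hT, h6]

omit [Module (ZMod p) V] [Fintype V] in
/-- The triangle count of the vendored statement (ordered triples `(x, y, z) ∈ X × Y × Z` with
`x + y + z = 0`) equals the pair count used in this file. [cite: FoxLovasz2017, §1] -/
theorem card_filter_triple_eq_card_tri (X Y Z : Finset V) :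
    ((X ×ˢ Y ×ˢ Z).filter fun t : V × V × V => t.1 + t.2.1 + t.2.2 = 0).card =
      (Tri[X, Y, Z]).card := by
  refine Finset.card_bij' (fun t _ => (t.1, t.2.1)) (fun t _ => (t.1, t.2, -(t.1 + t.2)))
    ?_ ?_ ?_ ?_
  · intro t ht
    simp only [mem_filter, mem_product] at ht
    obtain ⟨⟨h1, h2, h3⟩, h0⟩ := ht
    have h : t.2.2 = -(t.1 + t.2.1) := eq_neg_of_add_eq_zero_right h0
    exact mem_tri.2 ⟨h1, h2, h ▸ h3⟩
  · intro t ht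
    obtain ⟨h1, h2, h3⟩ := mem_tri.1 ht
    simp only [mem_filter, mem_product]
    exact ⟨⟨h1, h2, h3⟩, add_neg_cancel _⟩
  · intro t ht
    simp only [mem_filter, mem_product] at ht
    have h : t.2.2 = -(t.1 + t.2.1) := eq_neg_of_add_eq_zero_right ht.2
    exact Prod.ext rfl (Prod.ext rfl h.symm)
  · intro t _
    rfl

end Main

end FoxLovasz2017

/-- **Fox–Lovász 2017, Theorem 1, discharged**: the named fact `FoxLovasz2017_thm1` (tight
arithmetic triangle removal in `𝔽_pⁿ` with `δ = (ε/3)^{C_p}`) holds. Proof: the printed proof of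
§2 of the paper (Theorems 3 and 4, Lemmas 5 and 6, the `𝔽_p^{n+2}` embedding and the tensor-power
trick), with the tricolored sum-free bound supplied by BCCGNSU 2017, Thm. 4.14
(`BCCGNSU2017_thm414_holds`). [cite: FoxLovasz2017, Thm. 1] -/
theorem FoxLovasz2017_thm1_holds : FoxLovasz2017_thm1 := by
  intro p hp n ε hε0 _ X Y Z hT
  haveI : Fact p.Prime := ⟨hp⟩
  have hN : (Fintype.card (Fin n → ZMod p) : ℝ) = (p : ℝ) ^ n := by
    rw [Fintype.card_fun, ZMod.card, Fintype.card_fin]; push_cast; ring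
  rw [FoxLovasz2017.card_filter_triple_eq_card_tri, ← hN] at hT
  obtain ⟨R, hR, hgood⟩ := FoxLovasz2017.theorem1 hε0 X Y Z hT
  exact ⟨R, hN ▸ hR, hgood⟩

end Literature.Combinatorics.Additive

end
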